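import Mathlib.LinearAlgebra.Matrix.PosDef
import Mathlib.Algebra.Order.Star.Real
import Mathlib.LinearAlgebra.Eigenspace.Triangularizable
import Mathlib.Analysis.Complex.Polynomial.Basic
import Mathlib.Analysis.Normed.Module.FiniteDimension
import Mathlib.Analysis.InnerProductSpace.PiL2
import Mathlib.Topology.Order.IntermediateValue
import HarnessLib

/-!
# The stationary covariance of the harmonic chain between Langevin baths (Lyapunov equation)

Trunk T-KINETIC (Literature/MathematicalPhysics/KineticTheory). First decomposition step for the
named fact `Literature.Barriers.AtomisticToContinuum.HarmonicChainBallisticFlux`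
(`Literature/Barriers/AtomisticToContinuum/HarmonicCrystalBallistic.lean`; provefact unit): the
LINEAR ALGEBRA of the Rieder–Lebowitz–Lieb / Nakazawa solution of the harmonic chain
`pinnedChain ω₂ 0 0 γ` (`FouriersLaw.lean`) between Langevin baths, entirely PROVED.

## Source

Dhar, *Heat transport in low-dimensional systems*, Adv. Phys. 57 (2008), §3.1 "The
Rieder-Lebowitz-Lieb method" (arXiv:0808.3256, pp. 10–11): for `q̇ = -â q + η`,
`⟨η ηᵀ⟩ = D̂ δ(t-t')`, "In the steady state … `â·B̂ + B̂·âᵀ = D̂`. The solution of this equation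
gives the steady state correlation matrix `B̂` which completely determines the steady state since
we are dealing with a Gaussian process. In fact the steady state is given by the Gaussian
distribution `P({q_l}) = (2π)^{-N} Det[B̂]^{-1/2} e^{-½ qᵀ B̂⁻¹ q}`"; the block equations give
"`⟨x_l p_n/m_n⟩ = -⟨x_n p_l/m_l⟩`. Thus `⟨x_l p_l⟩ = 0`", the local energy balance
"`∑_n ⟨(Φ_ln x_n) p_l/m_l⟩ = γ_l (T^B_l - T_l)/m_l`" and "The energy current between two sites
is given by `J_{n→l} = -⟨(Φ_ln x_n) p_l/m_l⟩`". Roy–Dhar 2008, §2 eq. (2.1), (2.3): the chain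
Hamiltonian and its force matrix `Φ` (here `m = k = 1`, `k_o = ω₂`, `k' = 0`);
Bonetto–Lebowitz–Lukkarinen 2004, §2 (2.4), (2.10)–(2.14): the same Ornstein–Uhlenbeck
formulation, `S_eq = T diag(Φ⁻¹, 1)` at equal temperatures, linearity of the covariance in
the temperature profile.

## Contents (all proved)

* `IsHurwitz A` (every complex eigenvalue of the real matrix `A` has negative real part),
  `lyapunovOp A : X ↦ AX + XAᵀ`; `IsHurwitz.lyapunovOp_injective` (uniqueness for the Lyapunov
  equation: `X` kills the generalized eigenvectors of `-Aᵀ`, which span `ℂ^ι`), hence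
  bijective; `lyapSol A S` (the solution of `AX + XAᵀ + S = 0`) with its equation, uniqueness,
  linearity and transposition rules.
* `posDef_of_segment`: positivity propagates along a segment of symmetric matrices with trivial
  kernels (continuity of the minimum of the quadratic form on the unit sphere + IVT).
* The chain matrices over a commutative ring: `forceMatrix ω₂ N` (`Φ`, the constant Hessian of
  the harmonic potential energy, free ends), `frictionMatrix γ N` (`Γ = γ diag([i=0]+[i=N-1])`),
  `driftMatrix = [[0,1],[-Φ,-Γ]]`, `noiseMatrix = [[0,0],[0,diag(2γT_i)]]`, closed forms of
  `Φ u`, `u⋆Φu`, `u⋆Γu`, complexification lemmas.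
* `chain_propagation` (a solution of `Φu + μΓu + μ²u = 0` on the rows `0,…,N-2` vanishing at the
  left end vanishes: the chain is controlled from its end) and `isHurwitz_driftMatrix`
  (`ω₂, γ > 0`: eigenvalue equation paired with `u⋆` gives `c + bμ + aμ² = 0`, `a, c > 0`,
  `b = u⋆Γu ≥ 0`).
* `chainCov ω₂ γ N T_L T_R` (THE stationary covariance), `chainCov_lyapunov`, `eq_chainCov`
  (uniqueness), `chainCov_transpose`, `chainCov_eq_add` (linearity in `(T_L, T_R)`),
  `chainCov_self` (`C(T,T) = T·[[Φ⁻¹,0],[0,1]]`, the Gibbs covariance), `chainCov_mulVec_eq_zero`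
  (trivial kernel for `T_L > 0`, `T_R ≥ 0`: controllability again) and `chainCov_posDef`
  (`T_L, T_R > 0`).
* Block identities: `chainCov_inl_inr_antisymm` (`⟨q_i p_j⟩ = -⟨q_j p_i⟩`), `chainCov_inl_inr_self`,
  `chainCov_bond_succ`/`chainCov_bond_eq` (all bonds carry the same `⟨q_i p_{i+1}⟩`),
  `fluxCoeff ω₂ γ N := ⟨q_0 p_1⟩` at `(T_L,T_R) = (1,0)` and
  `chainCov_bond_eq_fluxCoeff : ⟨q_i p_{i+1}⟩_{(T_L,T_R)} = fluxCoeff · (T_L - T_R)`.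

The measure-theoretic part (the Gaussian with covariance `chainCov` is a weak steady state whose
bond currents have mean `⟨q_i p_{i+1}⟩`) is in `LinearLangevinGaussian.lean` and
`Literature/Barriers/AtomisticToContinuum/HarmonicCrystalBallisticProofs.lean`.

## Design choices

* Phase space is indexed by `Fin N ⊕ Fin N` (positions `inl`, momenta `inr`) so that Mathlib's
  `Matrix.fromBlocks` calculus applies; the bridge to `PhaseSpace N = (Fin N → ℝ) × (Fin N → ℝ)`
  is `flat` in `LinearLangevinGaussian.lean`.
* `forceMatrix` is written as the double bond sum `∑_{l=k+1} ([l=a]-[k=a])([l=b]-[k=b])` (the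
  Hessian of `∑ V(q_l - q_k)`), which makes `u⋆Φu = ω₂|u|² + ∑|u_l-u_k|²` immediate and matches
  `OscillatorChain.dPotential`; the tridiagonal closed form is `forceMatrix_mulVec_apply_eq`.
* Stability is used only through the spectrum (`IsHurwitz`), never through `e^{tA}`: existence
  of the covariance comes from injectivity of the Lyapunov operator (finite dimension), its
  positivity from the Gibbs anchor `C(T,T)` plus `posDef_of_segment`, so no matrix exponential /
  spectral-radius theory is needed.
* `lyapSol`/`chainCov`/`fluxCoeff` carry junk values (`0`) outside `ω₂, γ > 0` (documented).
-/

noncomputable section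

open Matrix Complex

namespace Literature.MathematicalPhysics.KineticTheory.HeatConduction

/-! ### Hurwitz matrices and the Lyapunov operator `X ↦ AX + XAᵀ` -/

section Lyapunov

variable {ι : Type*} [Fintype ι]

/-- A real square matrix is *Hurwitz stable* if every complex eigenvalue has negative real
part: whenever `A v = μ v` for a non-zero complex vector `v`, `Re μ < 0`. [folklore] -/
def IsHurwitz (A : Matrix ι ι ℝ) : Prop :=
  ∀ (μ : ℂ) (v : ι → ℂ), v ≠ 0 → (A.map (algebraMap ℝ ℂ)) *ᵥ v = μ • v → μ.re < 0

/-- `μ` is an eigenvalue of a complex matrix `M` iff `det (M - μ) = 0`. [folklore] -/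
theorem exists_mulVec_eq_smul_iff_det [DecidableEq ι] (M : Matrix ι ι ℂ) (μ : ℂ) :
    (∃ v : ι → ℂ, v ≠ 0 ∧ M *ᵥ v = μ • v) ↔ (M - μ • (1 : Matrix ι ι ℂ)).det = 0 := by
  rw [← Matrix.exists_mulVec_eq_zero_iff]
  constructor
  · rintro ⟨v, hv, h⟩
    refine ⟨v, hv, ?_⟩
    rw [sub_mulVec, smul_mulVec, one_mulVec, h, sub_self]
  · rintro ⟨v, hv, h⟩
    refine ⟨v, hv, ?_⟩
    rw [sub_mulVec, smul_mulVec, one_mulVec, sub_eq_zero] at h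
    exact h

/-- The transpose of a Hurwitz matrix is Hurwitz (same characteristic polynomial).
[folklore] -/
theorem IsHurwitz.transpose {A : Matrix ι ι ℝ} (hA : IsHurwitz A) : IsHurwitz Aᵀ := by
  classical
  intro μ v hv h
  have h1 : ∃ w : ι → ℂ, w ≠ 0 ∧ (Aᵀ.map (algebraMap ℝ ℂ)) *ᵥ w = μ • w := ⟨v, hv, h⟩
  rw [exists_mulVec_eq_smul_iff_det] at h1
  have h2 : ((A.map (algebraMap ℝ ℂ)) - μ • (1 : Matrix ι ι ℂ)).det = 0 := by
    rw [← det_transpose]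
    simpa [transpose_sub, transpose_smul, transpose_one, transpose_map] using h1
  rw [← exists_mulVec_eq_smul_iff_det] at h2
  obtain ⟨w, hw, hw'⟩ := h2
  exact hA μ w hw hw'

/-- The Lyapunov operator `X ↦ A X + X Aᵀ` of a real square matrix `A`. [folklore] -/
def lyapunovOp (A : Matrix ι ι ℝ) : Matrix ι ι ℝ →ₗ[ℝ] Matrix ι ι ℝ :=
  LinearMap.mulLeft ℝ A + LinearMap.mulRight ℝ Aᵀ

/-- Unfolding the Lyapunov operator. [folklore] -/
@[simp] theorem lyapunovOp_apply (A X : Matrix ι ι ℝ) : lyapunovOp A X = A * X + X * Aᵀ := rfl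

/-- A generalized eigenvector certifies an eigenvalue: if `(f - μ)^k w = 0` with `w ≠ 0` then
`μ` is an eigenvalue of `f`. [folklore] -/
theorem exists_eigenvector_of_pow_apply_eq_zero {V : Type*} [AddCommGroup V] [Module ℂ V]
    (f : Module.End ℂ V) (μ : ℂ) :
    ∀ (k : ℕ) (w : V), ((f - μ • 1) ^ k) w = 0 → w ≠ 0 → ∃ v : V, v ≠ 0 ∧ f v = μ • v := by
  intro k
  induction k with
  | zero =>
    intro w hw hne
    exact absurd (by simpa using hw) hne
  | succ k ih =>
    intro w hw hne
    by_cases h0 : (f - μ • 1) w = 0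
    · refine ⟨w, hne, ?_⟩
      have : f w - μ • w = 0 := by simpa using h0
      exact sub_eq_zero.mp this
    · rw [pow_succ, Module.End.mul_apply] at hw
      exact ih _ hw h0

/-- **Uniqueness for the Lyapunov equation.** If `A` is Hurwitz then `X ↦ AX + XAᵀ` is
injective: `spec(A) ∩ spec(-Aᵀ) = ∅`, so `AX = X(-Aᵀ)` forces `X` to kill every generalized
eigenvector of `-Aᵀ`, and these span `ℂ^ι`. [folklore] -/
theorem IsHurwitz.lyapunovOp_injective {A : Matrix ι ι ℝ} (hA : IsHurwitz A) :
    Function.Injective (lyapunovOp A) := by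
  classical
  rw [injective_iff_map_eq_zero]
  intro X hX
  simp only [lyapunovOp_apply] at hX
  -- complexify
  set φ : Matrix ι ι ℝ →+* Matrix ι ι ℂ := (algebraMap ℝ ℂ).mapMatrix with hφ
  set Ac : Matrix ι ι ℂ := φ A with hAc
  set Xc : Matrix ι ι ℂ := φ X with hXc
  have hAc' : Ac = A.map (algebraMap ℝ ℂ) := rfl
  have hAcT : φ Aᵀ = Acᵀ := by
    rw [hAc', RingHom.mapMatrix_apply, transpose_map]
  have hXc_eq : Ac * Xc = Xc * (-Acᵀ) := by
    have h := congrArg φ hX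
    rw [map_add, map_mul, map_mul, map_zero, hAcT] at h
    rw [Matrix.mul_neg, eq_neg_iff_add_eq_zero]
    exact h
  -- the endomorphism `-Acᵀ`
  set M : Module.End ℂ (ι → ℂ) := Matrix.toLin' (-Acᵀ) with hM
  have hM_apply : ∀ w, M w = (-Acᵀ) *ᵥ w := fun w => Matrix.toLin'_apply _ _
  -- key step: `Xc` kills all generalized eigenvectors of `M`
  have key : ∀ (μ : ℂ) (k : ℕ) (w : ι → ℂ), ((M - μ • 1) ^ k) w = 0 → Xc *ᵥ w = 0 := by
    intro μ k
    induction k with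
    | zero =>
      intro w hw
      have : w = 0 := by simpa using hw
      simp [this]
    | succ k ih =>
      intro w hw
      set w' := (M - μ • 1) w with hw'
      have hk : ((M - μ • 1) ^ k) w' = 0 := by
        rw [pow_succ, Module.End.mul_apply] at hw
        exact hw
      have h1 : Xc *ᵥ w' = 0 := ih w' hk
      have hw'_eq : w' = (-Acᵀ) *ᵥ w - μ • w := by
        simp [hw', hM_apply]
      -- `Ac (Xc w) = μ (Xc w)`
      have h2 : Ac *ᵥ (Xc *ᵥ w) = μ • (Xc *ᵥ w) := by
        rw [mulVec_mulVec, hXc_eq, ← mulVec_mulVec]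
        have : (-Acᵀ) *ᵥ w = w' + μ • w := by rw [hw'_eq]; abel
        rw [this, mulVec_add, h1, zero_add, mulVec_smul]
      by_contra hne
      have hneg : μ.re < 0 := hA μ _ hne (by rw [← hAc']; exact h2)
      -- `w ≠ 0`, so `μ` is an eigenvalue of `-Acᵀ`, i.e. `-μ` one of `Acᵀ`
      have hw0 : w ≠ 0 := by
        rintro rfl
        exact hne (by simp)
      obtain ⟨v, hv, hv'⟩ := exists_eigenvector_of_pow_apply_eq_zero M μ (k + 1) w hw hw0
      rw [hM_apply, neg_mulVec, neg_eq_iff_eq_neg, ← neg_smul] at hv'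
      have hpos : (-μ).re < 0 :=
        hA.transpose (-μ) v hv (by rw [transpose_map, ← hAc']; exact hv')
      rw [neg_re] at hpos
      linarith
  -- the generalized eigenvectors span everything
  have hXc0 : ∀ w : ι → ℂ, Xc *ᵥ w = 0 := by
    intro w
    have hw : w ∈ ⨆ μ : ℂ, M.maxGenEigenspace μ := by
      rw [Module.End.iSup_maxGenEigenspace_eq_top]; exact Submodule.mem_top
    refine Submodule.iSup_induction (p := fun μ : ℂ => M.maxGenEigenspace μ)
      (motive := fun w => Xc *ᵥ w = 0) hw ?_ (by simp) ?_
    · intro μ x hx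
      rw [Module.End.mem_maxGenEigenspace] at hx
      obtain ⟨k, hk⟩ := hx
      exact key μ k x hk
    · intro x y hx hy
      rw [mulVec_add, hx, hy, add_zero]
  have hXc1 : Xc = 0 := by
    ext i j
    have := congrFun (hXc0 (Pi.single j 1)) i
    simpa [mulVec_single_one] using this
  -- back to `ℝ`
  have hinj : Function.Injective φ := fun P Q h =>
    Matrix.map_injective (algebraMap ℝ ℂ).injective h
  exact hinj (by rw [← hXc, hXc1, map_zero])


/-- For a Hurwitz matrix the Lyapunov operator is a linear bijection of `Matrix ι ι ℝ`
(injective endomorphism of a finite-dimensional space). [folklore] -/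
theorem IsHurwitz.lyapunovOp_bijective {A : Matrix ι ι ℝ} (hA : IsHurwitz A) :
    Function.Bijective (lyapunovOp A) :=
  ⟨hA.lyapunovOp_injective, LinearMap.surjective_of_injective hA.lyapunovOp_injective⟩

open scoped Classical in
/-- The solution `X` of the Lyapunov equation `A X + X Aᵀ + S = 0` (junk value `0` when the
Lyapunov operator of `A` is not bijective, e.g. when `A` is not Hurwitz). For a Hurwitz drift
matrix `A` and a diffusion matrix `S = σσᵀ` this is the stationary covariance of the linear
stochastic differential equation `dX = AX dt + σ dW`. [Dhar 2008, §3.1, eq. `A·B + B·Aᵀ = D`]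
[cite: Dhar2008, §3.1] -/
def lyapSol (A S : Matrix ι ι ℝ) : Matrix ι ι ℝ :=
  if h : Function.Bijective (lyapunovOp A) then
    (LinearEquiv.ofBijective (lyapunovOp A) h).symm (-S) else 0

/-- The Lyapunov equation holds for `lyapSol A S` when `A` is Hurwitz. [folklore] -/
theorem IsHurwitz.lyapSol_eq {A : Matrix ι ι ℝ} (hA : IsHurwitz A) (S : Matrix ι ι ℝ) :
    A * lyapSol A S + lyapSol A S * Aᵀ + S = 0 := by
  have h := hA.lyapunovOp_bijective
  have e : lyapunovOp A (lyapSol A S) = -S := by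
    rw [lyapSol, dif_pos h]
    exact LinearEquiv.apply_symm_apply (LinearEquiv.ofBijective (lyapunovOp A) h) (-S)
  rw [lyapunovOp_apply] at e
  rw [e, neg_add_cancel]

/-- Uniqueness: any solution of `A X + X Aᵀ + S = 0` is `lyapSol A S` (`A` Hurwitz).
[folklore] -/
theorem IsHurwitz.eq_lyapSol {A : Matrix ι ι ℝ} (hA : IsHurwitz A) {S X : Matrix ι ι ℝ}
    (hX : A * X + X * Aᵀ + S = 0) : X = lyapSol A S := by
  apply hA.lyapunovOp_injective
  have h1 := hA.lyapSol_eq S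
  rw [lyapunovOp_apply, lyapunovOp_apply]
  rw [← sub_eq_zero]
  have : A * X + X * Aᵀ - (A * lyapSol A S + lyapSol A S * Aᵀ) =
      (A * X + X * Aᵀ + S) - (A * lyapSol A S + lyapSol A S * Aᵀ + S) := by abel
  rw [this, hX, h1, sub_zero]

/-- `lyapSol A` is additive in the right-hand side. [folklore] -/
theorem IsHurwitz.lyapSol_add {A : Matrix ι ι ℝ} (hA : IsHurwitz A) (S₁ S₂ : Matrix ι ι ℝ) :
    lyapSol A (S₁ + S₂) = lyapSol A S₁ + lyapSol A S₂ := by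
  symm
  apply hA.eq_lyapSol
  have h1 := hA.lyapSol_eq S₁
  have h2 := hA.lyapSol_eq S₂
  have : A * (lyapSol A S₁ + lyapSol A S₂) + (lyapSol A S₁ + lyapSol A S₂) * Aᵀ + (S₁ + S₂) =
      (A * lyapSol A S₁ + lyapSol A S₁ * Aᵀ + S₁) + (A * lyapSol A S₂ + lyapSol A S₂ * Aᵀ + S₂) := by
    rw [Matrix.mul_add, Matrix.add_mul]; abel
  rw [this, h1, h2, add_zero]

/-- `lyapSol A` is homogeneous in the right-hand side. [folklore] -/
theorem IsHurwitz.lyapSol_smul {A : Matrix ι ι ℝ} (hA : IsHurwitz A) (c : ℝ) (S : Matrix ι ι ℝ) :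
    lyapSol A (c • S) = c • lyapSol A S := by
  symm
  apply hA.eq_lyapSol
  have h1 := hA.lyapSol_eq S
  have : A * (c • lyapSol A S) + (c • lyapSol A S) * Aᵀ + c • S =
      c • (A * lyapSol A S + lyapSol A S * Aᵀ + S) := by
    rw [Matrix.mul_smul, Matrix.smul_mul, smul_add, smul_add]
  rw [this, h1, smul_zero]

/-- `lyapSol A 0 = 0`. [folklore] -/
theorem IsHurwitz.lyapSol_zero {A : Matrix ι ι ℝ} (hA : IsHurwitz A) :
    lyapSol A (0 : Matrix ι ι ℝ) = 0 := by
  symm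
  apply hA.eq_lyapSol
  simp

/-- Transposing the right-hand side transposes the solution; in particular a symmetric
right-hand side has a symmetric solution. [folklore] -/
theorem IsHurwitz.lyapSol_transpose {A : Matrix ι ι ℝ} (hA : IsHurwitz A) (S : Matrix ι ι ℝ) :
    (lyapSol A S)ᵀ = lyapSol A Sᵀ := by
  apply hA.eq_lyapSol
  have h1 := hA.lyapSol_eq S
  have h2 := congrArg Matrix.transpose h1
  rw [transpose_add, transpose_add, transpose_mul, transpose_mul, transpose_transpose,
    transpose_zero] at h2
  rw [← h2]
  abel

/-- A symmetric right-hand side has a symmetric solution. [folklore] -/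
theorem IsHurwitz.lyapSol_transpose_of_symm {A : Matrix ι ι ℝ} (hA : IsHurwitz A)
    {S : Matrix ι ι ℝ} (hS : Sᵀ = S) : (lyapSol A S)ᵀ = lyapSol A S := by
  rw [hA.lyapSol_transpose, hS]

/-! ### Real symmetric matrices: kernel of a positive semidefinite form, positivity along a segment -/

omit [Fintype ι] in
/-- For a real symmetric matrix, `v ⬝ᵥ K *ᵥ w = w ⬝ᵥ K *ᵥ v`. [folklore] -/
theorem dotProduct_mulVec_comm_of_transpose_eq [Fintype ι] {K : Matrix ι ι ℝ} (hK : Kᵀ = K)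
    (v w : ι → ℝ) : v ⬝ᵥ (K *ᵥ w) = w ⬝ᵥ (K *ᵥ v) := by
  rw [dotProduct_mulVec, ← mulVec_transpose, hK, dotProduct_comm]

/-- If a real symmetric matrix has a non-negative quadratic form which vanishes at `v`, then
`K v = 0`. [folklore] -/
theorem mulVec_eq_zero_of_dotProduct_mulVec_eq_zero {K : Matrix ι ι ℝ} (hK : Kᵀ = K)
    (hpsd : ∀ w : ι → ℝ, 0 ≤ w ⬝ᵥ (K *ᵥ w)) {v : ι → ℝ} (hv : v ⬝ᵥ (K *ᵥ v) = 0) :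
    K *ᵥ v = 0 := by
  -- the linear coefficient of `t ↦ (v + t w)ᵀ K (v + t w) ≥ 0` vanishes
  have hlin : ∀ w : ι → ℝ, w ⬝ᵥ (K *ᵥ v) = 0 := by
    intro w
    set b := w ⬝ᵥ (K *ᵥ v) with hb
    set c := w ⬝ᵥ (K *ᵥ w) with hc
    have hc0 : 0 ≤ c := hpsd w
    have hquad : ∀ t : ℝ, 0 ≤ 2 * b * t + c * t ^ 2 := by
      intro t
      have h := hpsd (v + t • w)
      have hexp : (v + t • w) ⬝ᵥ (K *ᵥ (v + t • w)) = 2 * b * t + c * t ^ 2 := by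
        rw [mulVec_add, mulVec_smul, add_dotProduct, dotProduct_add, dotProduct_add,
          smul_dotProduct, smul_dotProduct, dotProduct_smul, dotProduct_smul, hv,
          dotProduct_mulVec_comm_of_transpose_eq hK v w]
        simp only [smul_eq_mul]
        ring
      rw [hexp] at h
      exact h
    have h := hquad (-b / (c + 1))
    have hc1 : 0 < c + 1 := by linarith
    have h' : 0 ≤ -(b ^ 2) * (c + 2) := by
      have e : 2 * b * (-b / (c + 1)) + c * (-b / (c + 1)) ^ 2 =
          (-(b ^ 2) * (c + 2)) / (c + 1) ^ 2 := by
        field_simp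
        ring
      rw [e] at h
      exact (div_nonneg_iff.mp h).elim (fun h => h.1) (fun h => by nlinarith [h.2])
    nlinarith [sq_nonneg b]
  have h := hlin (K *ᵥ v)
  exact dotProduct_self_eq_zero.mp h

/-- Entrywise bound for the quadratic form on the unit ball of the sup norm:
`|v ⬝ᵥ K v| ≤ ∑_{a,b} |K a b|` if `‖v‖ ≤ 1`. [folklore] -/
theorem abs_dotProduct_mulVec_le {K : Matrix ι ι ℝ} {v : ι → ℝ} (hv : ‖v‖ ≤ 1) :
    |v ⬝ᵥ (K *ᵥ v)| ≤ ∑ a, ∑ b, |K a b| := by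
  have hva : ∀ a, |v a| ≤ 1 := fun a => (norm_le_pi_norm v a).trans hv
  simp only [dotProduct, mulVec, Finset.mul_sum]
  refine (Finset.abs_sum_le_sum_abs _ _).trans (Finset.sum_le_sum fun a _ => ?_)
  refine (Finset.abs_sum_le_sum_abs _ _).trans (Finset.sum_le_sum fun b _ => ?_)
  rw [abs_mul, abs_mul]
  calc |v a| * (|K a b| * |v b|) ≤ 1 * (|K a b| * 1) := by
        apply mul_le_mul (hva a) _ (by positivity) zero_le_one
        exact mul_le_mul_of_nonneg_left (hva b) (abs_nonneg _)
    _ = |K a b| := by ring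

/-- **Positivity propagates along a segment of non-singular symmetric matrices.** Let
`K₀` be positive definite and `K₁` symmetric, and suppose every matrix
`K₀ + s (K₁ - K₀)`, `s ∈ [0, 1]`, of the segment joining them has trivial kernel. Then `K₁`
is positive definite: the smallest value of the quadratic form on the unit sphere is a
continuous function of `s` which cannot vanish (a non-negative form vanishing at a unit
vector has that vector in its kernel), so it keeps the sign it has at `s = 0`. [folklore] -/
theorem posDef_of_segment [DecidableEq ι] {K₀ K₁ : Matrix ι ι ℝ} (h₀ : K₀.PosDef)
    (h₁ : K₁ᵀ = K₁)
    (hker : ∀ s ∈ Set.Icc (0 : ℝ) 1, ∀ v : ι → ℝ, (K₀ + s • (K₁ - K₀)) *ᵥ v = 0 → v = 0) :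
    K₁.PosDef := by
  have h₀T : K₀ᵀ = K₀ := by
    have := h₀.isHermitian
    rw [Matrix.IsHermitian, conjTranspose_eq_transpose_of_trivial] at this
    exact this
  -- the segment and its quadratic form
  set P : ℝ → Matrix ι ι ℝ := fun s => K₀ + s • (K₁ - K₀) with hP
  have hPT : ∀ s, (P s)ᵀ = P s := by
    intro s
    simp only [hP, transpose_add, transpose_smul, transpose_sub, h₀T, h₁]
  set q : ℝ → (ι → ℝ) → ℝ := fun s v => v ⬝ᵥ (P s *ᵥ v) with hq
  have hq_lin : ∀ s v, q s v = v ⬝ᵥ (K₀ *ᵥ v) + s * (v ⬝ᵥ ((K₁ - K₀) *ᵥ v)) := by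
    intro s v
    simp only [hq, hP, add_mulVec, smul_mulVec, dotProduct_add, dotProduct_smul, smul_eq_mul]
  have hq_smul : ∀ s (c : ℝ) v, q s (c • v) = c ^ 2 * q s v := by
    intro s c v
    simp only [hq, mulVec_smul, smul_dotProduct, dotProduct_smul, smul_eq_mul]
    ring
  have hq1 : ∀ v, q 1 v = v ⬝ᵥ (K₁ *ᵥ v) := by
    intro v
    simp only [hq, hP, one_smul, add_sub_cancel]
  -- positive definiteness of `K₁` from positivity of `q 1` on non-zero vectors
  suffices hmain : ∀ v : ι → ℝ, v ≠ 0 → 0 < q 1 v by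
    refine Matrix.PosDef.of_dotProduct_mulVec_pos ?_ fun v hv => ?_
    · rw [Matrix.IsHermitian, conjTranspose_eq_transpose_of_trivial, h₁]
    · rw [star_trivial, ← hq1]
      exact hmain v hv
  -- trivial when `ι` is empty
  rcases isEmpty_or_nonempty ι with hι | hι
  · intro v hv
    exact absurd (Subsingleton.elim v 0) hv
  -- the unit sphere of the sup norm
  set Sph : Set (ι → ℝ) := Metric.sphere (0 : ι → ℝ) 1 with hSph
  have hSc : IsCompact Sph := isCompact_sphere 0 1
  have hSne : Sph.Nonempty := NormedSpace.sphere_nonempty.mpr zero_le_one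
  have hmemS : ∀ v ∈ Sph, ‖v‖ = 1 := fun v hv => by simpa [hSph] using hv
  have hq_cont : ∀ s, Continuous (q s) := by
    intro s
    simp only [hq]
    fun_prop
  -- minimisers on the sphere
  have hmin : ∀ s, ∃ v ∈ Sph, ∀ w ∈ Sph, q s v ≤ q s w := fun s =>
    hSc.exists_isMinOn hSne (hq_cont s).continuousOn
  choose vmin hvS hvmin using hmin
  set m : ℝ → ℝ := fun s => q s (vmin s) with hm
  -- Lipschitz continuity of `m`
  set Mb : ℝ := ∑ a, ∑ b, |(K₁ - K₀) a b| with hMb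
  have hMb0 : 0 ≤ Mb := Finset.sum_nonneg fun a _ => Finset.sum_nonneg fun b _ => abs_nonneg _
  have hbound : ∀ v ∈ Sph, |v ⬝ᵥ ((K₁ - K₀) *ᵥ v)| ≤ Mb := fun v hv =>
    abs_dotProduct_mulVec_le (le_of_eq (hmemS v hv))
  have hm_le : ∀ s t, m t ≤ m s + Mb * |t - s| := by
    intro s t
    calc m t ≤ q t (vmin s) := hvmin t (vmin s) (hvS s)
      _ = q s (vmin s) + (t - s) * (vmin s ⬝ᵥ ((K₁ - K₀) *ᵥ vmin s)) := by
          rw [hq_lin, hq_lin]; ring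
      _ ≤ m s + |t - s| * Mb := by
          have := hbound (vmin s) (hvS s)
          have h2 : (t - s) * (vmin s ⬝ᵥ ((K₁ - K₀) *ᵥ vmin s)) ≤ |t - s| * Mb := by
            calc (t - s) * (vmin s ⬝ᵥ ((K₁ - K₀) *ᵥ vmin s))
                ≤ |(t - s) * (vmin s ⬝ᵥ ((K₁ - K₀) *ᵥ vmin s))| := le_abs_self _
              _ = |t - s| * |vmin s ⬝ᵥ ((K₁ - K₀) *ᵥ vmin s)| := abs_mul _ _
              _ ≤ |t - s| * Mb := mul_le_mul_of_nonneg_left this (abs_nonneg _)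
          simp only [hm]
          linarith
      _ = m s + Mb * |t - s| := by ring
  have hm_cont : Continuous m := by
    have hL : LipschitzWith (Real.toNNReal Mb) m := by
      refine LipschitzWith.of_dist_le_mul fun s t => ?_
      rw [Real.dist_eq, Real.dist_eq, abs_sub_le_iff, Real.coe_toNNReal Mb hMb0]
      constructor
      · have := hm_le t s
        linarith
      · have := hm_le s t
        rw [abs_sub_comm] at this
        linarith
    exact hL.continuous
  -- `m` never vanishes on `[0, 1]`
  have hm_ne : ∀ s ∈ Set.Icc (0 : ℝ) 1, m s ≠ 0 := by
    intro s hs hms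
    -- `q s ≥ 0` everywhere
    have hnn : ∀ w : ι → ℝ, 0 ≤ q s w := by
      intro w
      by_cases hw : w = 0
      · subst hw
        simp [hq]
      · have hnw : ‖w‖ ≠ 0 := norm_ne_zero_iff.mpr hw
        have hu : ‖w‖⁻¹ • w ∈ Sph := by
          simp [hSph, norm_smul, hnw]
        have h1 : 0 ≤ q s (‖w‖⁻¹ • w) := by
          have := hvmin s _ hu
          have hms' : q s (vmin s) = 0 := hms
          linarith
        rw [hq_smul] at h1
        have h2 : 0 < (‖w‖⁻¹) ^ 2 := by positivity
        exact nonneg_of_mul_nonneg_right (by simpa [mul_comm] using h1) h2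
    have hker' := mulVec_eq_zero_of_dotProduct_mulVec_eq_zero (hPT s) hnn
      (v := vmin s) (by simpa [hm] using hms)
    have h0 : vmin s = 0 := hker s hs (vmin s) hker'
    have := hmemS (vmin s) (hvS s)
    rw [h0, norm_zero] at this
    exact zero_ne_one this
  -- `m 0 > 0`
  have hm0 : 0 < m 0 := by
    have hv0 : vmin 0 ≠ 0 := by
      intro h
      have := hmemS (vmin 0) (hvS 0)
      rw [h, norm_zero] at this
      exact zero_ne_one this
    have := h₀.dotProduct_mulVec_pos hv0
    rw [star_trivial] at this
    simp only [hm, hq_lin, zero_mul, add_zero]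
    exact this
  -- hence `m 1 > 0` by the intermediate value theorem
  have hm1 : 0 < m 1 := by
    by_contra hle
    have hle : m 1 ≤ 0 := not_lt.mp hle
    have hIVT := intermediate_value_Icc' (zero_le_one' ℝ) hm_cont.continuousOn
    have h0mem : (0 : ℝ) ∈ Set.Icc (m 1) (m 0) := ⟨hle, hm0.le⟩
    obtain ⟨s, hs, hs0⟩ := hIVT h0mem
    exact hm_ne s hs hs0
  -- conclusion
  intro v hv
  have hnv : ‖v‖ ≠ 0 := norm_ne_zero_iff.mpr hv
  have hu : ‖v‖⁻¹ • v ∈ Sph := by simp [hSph, norm_smul, hnv]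
  have h1 : m 1 ≤ q 1 (‖v‖⁻¹ • v) := hvmin 1 _ hu
  rw [hq_smul] at h1
  have h2 : 0 < (‖v‖⁻¹) ^ 2 * q 1 v := lt_of_lt_of_le hm1 h1
  exact pos_of_mul_pos_right h2 (by positivity)

end Lyapunov

/-! ### The matrices of the harmonic chain `pinnedChain ω₂ 0 0 γ` -/

section ChainMatrices

variable {R : Type*} [CommRing R]

/-- The force (coupling) matrix `Φ = ω₂ 1 + (-Δ_free)` of the pinned harmonic chain with `N`
sites and free ends, written as the constant Hessian of the potential energy
`Φ_q(q) = ∑_i ω₂ q_i²/2 + ∑_{l = k+1} (q_l - q_k)²/2`: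
`Φ a b = ω₂ [a = b] + ∑_{l = k+1} ([l = a] - [k = a]) ([l = b] - [k = b])`, i.e. the tridiagonal
matrix with diagonal `ω₂ + deg(a)` (`deg = 1` at the two ends, `2` inside) and off-diagonal
entries `-1`. Defined over any commutative ring so that its complexification is the same
expression. [Roy–Dhar 2008, §2 eq. (2.3) (`k = m = 1`, `k_o = ω₂`, `k' = 0`); Dhar 2008, §3.1]
[cite: RoyDhar2008, §2 eq. (2.3)] -/
def forceMatrix (ω₂ : R) (N : ℕ) : Matrix (Fin N) (Fin N) R := fun a b =>
  ω₂ * (if a = b then 1 else 0) + ∑ k : Fin N, ∑ l : Fin N,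
    if l.val = k.val + 1 then
      ((if l = a then 1 else 0) - (if k = a then 1 else 0)) *
        ((if l = b then 1 else 0) - (if k = b then 1 else 0)) else 0

/-- The bath multiplicity `[i = 0] + [i = N-1]` of site `i` (both baths act on the single site
of a one-site chain), over a commutative ring. [folklore] -/
def bathMult (N : ℕ) (i : Fin N) : R :=
  (if i.val = 0 then 1 else 0) + (if i.val = N - 1 then 1 else 0)

/-- The friction matrix `Γ = γ diag([i = 0] + [i = N-1])` of the Langevin baths at the two ends.
[Dhar 2008, §3.1 (`Γ_{ln} = γ_l δ_{ln}`)] [cite: Dhar2008, §3.1] -/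
def frictionMatrix (γ : R) (N : ℕ) : Matrix (Fin N) (Fin N) R :=
  Matrix.diagonal fun i => γ * bathMult N i

/-- The drift matrix `A = [[0, 1], [-Φ, -Γ]]` of the linear Langevin dynamics
`dq = p dt`, `dp = (-Φ q - Γ p) dt + noise` of the harmonic chain on phase space
`ℝ^N ⊕ ℝ^N` (positions `inl`, momenta `inr`). [Dhar 2008, §3.1 (`q̇ = -a·q + η`, with
`a = -A` here); Bonetto–Lebowitz–Lukkarinen 2004, eq. (2.4)] [cite: Dhar2008, §3.1] -/
def driftMatrix (ω₂ γ : R) (N : ℕ) : Matrix (Fin N ⊕ Fin N) (Fin N ⊕ Fin N) R :=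
  Matrix.fromBlocks 0 1 (-forceMatrix ω₂ N) (-frictionMatrix γ N)

/-- The bath temperature profile `[i = 0] T_L + [i = N-1] T_R`. [folklore] -/
def bathTemp (N : ℕ) (T_L T_R : R) (i : Fin N) : R :=
  (if i.val = 0 then T_L else 0) + (if i.val = N - 1 then T_R else 0)

/-- The diffusion (noise covariance) matrix `Σ = [[0, 0], [0, diag(2γ([i=0]T_L + [i=N-1]T_R))]]`
of the Langevin baths (`dp_i = … + √(2γT_i) dW_i` at the bath sites).
[Dhar 2008, §3.1 (`E_{ln} = 2 k_B T_l γ_l δ_{ln}`)] [cite: Dhar2008, §3.1] -/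
def noiseMatrix (γ : R) (N : ℕ) (T_L T_R : R) : Matrix (Fin N ⊕ Fin N) (Fin N ⊕ Fin N) R :=
  Matrix.fromBlocks 0 0 0 (Matrix.diagonal fun i => 2 * γ * bathTemp N T_L T_R i)

/-! ### Closed forms -/

/-- Evaluation of the bond double sum against the difference of indicators:
`∑_{l = k+1} ([l = a] - [k = a]) g k l = [a ≥ 1] g (a-1) a - [a+1 < N] g a (a+1)`. [folklore] -/
theorem sum_sum_succ_indicator {M : Type*} [AddCommGroup M] [Module R M] {N : ℕ}
    (g : Fin N → Fin N → M) (a : Fin N) :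
    (∑ k : Fin N, ∑ l : Fin N, if l.val = k.val + 1 then
      (((if l = a then 1 else 0) - (if k = a then 1 else 0) : R) • g k l) else 0) =
      (if h : 0 < a.val then g ⟨a.val - 1, by omega⟩ a else 0) -
        (if h : a.val + 1 < N then g a ⟨a.val + 1, h⟩ else 0) := by
  have hsplit : ∀ k l : Fin N, (if l.val = k.val + 1 then
      (((if l = a then 1 else 0) - (if k = a then 1 else 0) : R) • g k l) else 0) =
      (if l.val = k.val + 1 ∧ l = a then g k l else 0) -
        (if l.val = k.val + 1 ∧ k = a then g k l else 0) := by
    intro k l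
    by_cases h1 : l.val = k.val + 1
    · by_cases h2 : l = a
      · have h3 : k ≠ a := by
          rintro rfl
          rw [h2] at h1
          omega
        simp [h2, h3]
      · by_cases h3 : k = a
        · simp [h1, h2, h3]
        · simp [h2, h3]
    · simp [h1]
  simp_rw [hsplit, Finset.sum_sub_distrib]
  congr 1
  · -- the term `l = a`, `k = a - 1`
    rw [Finset.sum_comm]
    rw [Finset.sum_eq_single_of_mem a (Finset.mem_univ a)]
    · by_cases h : 0 < a.val
      · rw [dif_pos h, Finset.sum_eq_single_of_mem (⟨a.val - 1, by omega⟩ : Fin N)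
          (Finset.mem_univ _)]
        · rw [if_pos]
          exact ⟨by simp only; omega, rfl⟩
        · intro k _ hk
          rw [if_neg]
          rintro ⟨h1, -⟩
          apply hk
          ext
          simp only
          omega
      · rw [dif_neg h]
        refine Finset.sum_eq_zero fun k _ => ?_
        rw [if_neg]
        rintro ⟨h1, -⟩
        omega
    · intro l _ hl
      refine Finset.sum_eq_zero fun k _ => ?_
      rw [if_neg]
      rintro ⟨-, h2⟩
      exact hl h2
  · -- the term `k = a`, `l = a + 1`
    rw [Finset.sum_eq_single_of_mem a (Finset.mem_univ a)]
    · by_cases h : a.val + 1 < N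
      · rw [dif_pos h, Finset.sum_eq_single_of_mem (⟨a.val + 1, h⟩ : Fin N) (Finset.mem_univ _)]
        · rw [if_pos]
          exact ⟨rfl, rfl⟩
        · intro l _ hl
          rw [if_neg]
          rintro ⟨h1, -⟩
          apply hl
          ext
          simp only
          omega
      · rw [dif_neg h]
        refine Finset.sum_eq_zero fun l _ => ?_
        rw [if_neg]
        rintro ⟨h1, -⟩
        omega
    · intro k _ hk
      refine Finset.sum_eq_zero fun l _ => ?_
      rw [if_neg]
      rintro ⟨-, h2⟩
      exact hk h2

/-- The force matrix is symmetric. [folklore] -/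
theorem forceMatrix_transpose (ω₂ : R) (N : ℕ) : (forceMatrix ω₂ N)ᵀ = forceMatrix ω₂ N := by
  ext a b
  simp only [transpose_apply, forceMatrix]
  congr 1
  · by_cases h : a = b
    · subst h; rfl
    · rw [if_neg h, if_neg (Ne.symm h)]
  · exact Finset.sum_congr rfl fun k _ => Finset.sum_congr rfl fun l _ => by
      split_ifs <;> ring

/-- The friction matrix is symmetric (diagonal). [folklore] -/
theorem frictionMatrix_transpose (γ : R) (N : ℕ) :
    (frictionMatrix γ N)ᵀ = frictionMatrix γ N :=
  Matrix.diagonal_transpose _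

/-- The noise matrix is symmetric (diagonal). [folklore] -/
theorem noiseMatrix_transpose (γ : R) (N : ℕ) (T_L T_R : R) :
    (noiseMatrix γ N T_L T_R)ᵀ = noiseMatrix γ N T_L T_R := by
  simp only [noiseMatrix, fromBlocks_transpose, transpose_zero, diagonal_transpose]

/-- Transpose of the drift matrix: `Aᵀ = [[0, -Φ], [1, -Γ]]`. [folklore] -/
theorem driftMatrix_transpose (ω₂ γ : R) (N : ℕ) :
    (driftMatrix ω₂ γ N)ᵀ = Matrix.fromBlocks 0 (-forceMatrix ω₂ N) 1 (-frictionMatrix γ N) := by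
  rw [driftMatrix, fromBlocks_transpose, transpose_zero, transpose_one, transpose_neg,
    transpose_neg, forceMatrix_transpose, frictionMatrix_transpose]

/-- Action of the force matrix:
`(Φ u)_a = ω₂ u_a + ∑_{l = k+1} ([l = a] - [k = a]) (u_l - u_k)`. [folklore] -/
theorem forceMatrix_mulVec_apply (ω₂ : R) {N : ℕ} (u : Fin N → R) (a : Fin N) :
    (forceMatrix ω₂ N *ᵥ u) a = ω₂ * u a + ∑ k : Fin N, ∑ l : Fin N,
      if l.val = k.val + 1 then
        ((if l = a then 1 else 0) - (if k = a then 1 else 0)) * (u l - u k) else 0 := by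
  have hΦ : ∀ b, forceMatrix ω₂ N a b = ω₂ * (if a = b then 1 else 0) + ∑ k : Fin N, ∑ l : Fin N,
      if l.val = k.val + 1 then ((if l = a then 1 else 0) - (if k = a then 1 else 0)) *
        ((if l = b then 1 else 0) - (if k = b then 1 else 0)) else 0 := fun b => rfl
  simp only [mulVec, dotProduct, hΦ, add_mul, Finset.sum_add_distrib, Finset.sum_mul]
  congr 1
  · simp only [mul_assoc, ite_mul, one_mul, zero_mul, ← Finset.mul_sum]
    rw [Finset.sum_ite_eq]
    simp
  · rw [Finset.sum_comm]
    refine Finset.sum_congr rfl fun k _ => ?_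
    rw [Finset.sum_comm]
    refine Finset.sum_congr rfl fun l _ => ?_
    by_cases h : l.val = k.val + 1
    · simp only [h, if_true]
      simp_rw [mul_assoc]
      rw [← Finset.mul_sum]
      congr 1
      simp only [sub_mul, Finset.sum_sub_distrib, ite_mul, one_mul, zero_mul, Finset.sum_ite_eq,
        Finset.mem_univ, if_true]
    · simp [h]

/-- Closed form of a row of `Φ u`:
`(Φ u)_a = ω₂ u_a + [a ≥ 1](u_a - u_{a-1}) - [a + 1 < N](u_{a+1} - u_a)`. [folklore] -/
theorem forceMatrix_mulVec_apply_eq (ω₂ : R) {N : ℕ} (u : Fin N → R) (a : Fin N) :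
    (forceMatrix ω₂ N *ᵥ u) a = ω₂ * u a +
      ((if h : 0 < a.val then u a - u ⟨a.val - 1, by omega⟩ else 0) -
        (if h : a.val + 1 < N then u ⟨a.val + 1, h⟩ - u a else 0)) := by
  rw [forceMatrix_mulVec_apply]
  congr 1
  have h := sum_sum_succ_indicator (R := R) (fun k l : Fin N => u l - u k) a
  simp only [smul_eq_mul] at h
  rw [h]

/-- The quadratic form of the force matrix against `star`:
`u⋆ Φ u = ω₂ ∑_a u_a⋆ u_a + ∑_{l = k+1} (u_l - u_k)⋆ (u_l - u_k)`. [folklore] -/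
theorem star_dotProduct_forceMatrix_mulVec [StarRing R] (ω₂ : R) {N : ℕ} (u : Fin N → R) :
    star u ⬝ᵥ (forceMatrix ω₂ N *ᵥ u) = ω₂ * ∑ a, star (u a) * u a +
      ∑ k : Fin N, ∑ l : Fin N,
        if l.val = k.val + 1 then star (u l - u k) * (u l - u k) else 0 := by
  simp only [dotProduct, forceMatrix_mulVec_apply, Pi.star_apply, mul_add, Finset.sum_add_distrib,
    Finset.mul_sum]
  congr 1
  · refine Finset.sum_congr rfl fun a _ => ?_
    ring
  · rw [Finset.sum_comm]
    refine Finset.sum_congr rfl fun k _ => ?_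
    rw [Finset.sum_comm]
    refine Finset.sum_congr rfl fun l _ => ?_
    by_cases h : l.val = k.val + 1
    · simp only [h, if_true]
      have e1 : ∀ a : Fin N, star (u a) * (((if l = a then (1 : R) else 0) -
          (if k = a then 1 else 0)) * (u l - u k)) =
          ((if l = a then star (u a) else 0) - (if k = a then star (u a) else 0)) * (u l - u k) := by
        intro a
        split_ifs <;> ring
      simp only [e1, ← Finset.sum_mul, Finset.sum_sub_distrib, Finset.sum_ite_eq, Finset.mem_univ,
        if_true, star_sub]
    · simp [h]

/-- The quadratic form of the friction matrix: `u⋆ Γ u = γ ∑ ([i=0] + [i=N-1]) u_i⋆ u_i`.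
[folklore] -/
theorem star_dotProduct_frictionMatrix_mulVec [StarRing R] (γ : R) {N : ℕ} (u : Fin N → R) :
    star u ⬝ᵥ (frictionMatrix γ N *ᵥ u) = γ * ∑ i, bathMult N i * (star (u i) * u i) := by
  simp only [frictionMatrix, mulVec_diagonal, dotProduct, Pi.star_apply, Finset.mul_sum]
  refine Finset.sum_congr rfl fun i _ => ?_
  ring

/-- Complexification of the force matrix. [folklore] -/
theorem forceMatrix_map_ofReal (ω₂ : ℝ) (N : ℕ) :
    (forceMatrix ω₂ N).map (algebraMap ℝ ℂ) = forceMatrix (ω₂ : ℂ) N := by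
  ext a b
  simp only [map_apply, forceMatrix, Complex.coe_algebraMap]
  push_cast
  congr 1
  · split_ifs <;> simp
  · refine Finset.sum_congr rfl fun k _ => Finset.sum_congr rfl fun l _ => ?_
    split_ifs <;> simp

/-- Complexification of the friction matrix. [folklore] -/
theorem frictionMatrix_map_ofReal (γ : ℝ) (N : ℕ) :
    (frictionMatrix γ N).map (algebraMap ℝ ℂ) = frictionMatrix (γ : ℂ) N := by
  ext a b
  simp only [map_apply, frictionMatrix, bathMult, diagonal_apply, Complex.coe_algebraMap]
  by_cases h : a = b
  · simp only [h, if_true]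
    push_cast
    split_ifs <;> simp
  · simp [h]

/-- Complexification of the drift matrix. [folklore] -/
theorem driftMatrix_map_ofReal (ω₂ γ : ℝ) (N : ℕ) :
    (driftMatrix ω₂ γ N).map (algebraMap ℝ ℂ) = driftMatrix (ω₂ : ℂ) (γ : ℂ) N := by
  rw [driftMatrix, fromBlocks_map, driftMatrix, ← forceMatrix_map_ofReal,
    ← frictionMatrix_map_ofReal, Matrix.map_zero _ (map_zero _),
    Matrix.map_one _ (map_zero _) (map_one _), Matrix.map_neg _ (map_neg _),
    Matrix.map_neg _ (map_neg _)]

end ChainMatrices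

/-! ### Stability: the drift matrix is Hurwitz (energy dissipation + propagation along the chain) -/

section Hurwitz

variable {R : Type*} [CommRing R]

/-- **Propagation along the chain.** If `u` solves the rows `a = 0, …, N-2` of
`Φ u + μ Γ u + μ² u = 0` and vanishes at the left end, then `u = 0`: row `a` determines
`u_{a+1}` from `u_a, u_{a-1}` because the super-diagonal entry of `Φ` is `-1 ≠ 0`. This is the
rank condition making the chain controllable/observable from its left end. [folklore] -/
theorem chain_propagation {N : ℕ} (ω₂ γ μ : R) (u : Fin N → R)
    (hrow : ∀ a : Fin N, a.val + 1 < N →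
      (forceMatrix ω₂ N *ᵥ u) a + μ * (frictionMatrix γ N *ᵥ u) a + μ ^ 2 * u a = 0)
    (h0 : ∀ a : Fin N, a.val = 0 → u a = 0) : u = 0 := by
  suffices h : ∀ n : ℕ, ∀ a : Fin N, a.val ≤ n → u a = 0 by
    funext a
    exact h a.val a le_rfl
  intro n
  induction n with
  | zero =>
    intro a ha
    exact h0 a (Nat.le_zero.mp ha)
  | succ n ih =>
    intro a ha
    rcases Nat.lt_or_ge a.val (n + 1) with hlt | hge
    · exact ih a (by omega)
    · have haeq : a.val = n + 1 := le_antisymm ha hge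
      have hn : n + 1 < N := haeq ▸ a.isLt
      set a' : Fin N := ⟨n, by omega⟩ with ha'
      have hrow' := hrow a' (by simp [ha']; omega)
      rw [forceMatrix_mulVec_apply_eq, frictionMatrix, mulVec_diagonal] at hrow'
      have hu' : u a' = 0 := ih a' (by simp [ha'])
      have hprev : (if h : 0 < a'.val then u a' - u ⟨a'.val - 1, by omega⟩ else 0) = 0 := by
        split_ifs with h
        · rw [hu', ih ⟨a'.val - 1, by omega⟩ (by simp [ha']), sub_zero]
        · rfl
      have hnext : (if h : a'.val + 1 < N then u ⟨a'.val + 1, h⟩ - u a' else 0) =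
          u ⟨n + 1, hn⟩ := by
        rw [dif_pos (by simp [ha']; omega), hu', sub_zero]
      rw [hprev, hnext, hu'] at hrow'
      have : u ⟨n + 1, hn⟩ = 0 := by
        have h := hrow'
        simp only [mul_zero, zero_add, zero_sub, add_zero, neg_eq_zero] at h
        exact h
      have hae : a = ⟨n + 1, hn⟩ := Fin.ext haeq
      rw [hae]
      exact this

/-- Roots of `a μ² + b μ + c = 0` with `a, c > 0`, `b ≥ 0` lie in the open left half-plane
unless `b = 0`. [folklore] -/
theorem re_neg_or_eq_zero_of_quadratic {a b c : ℝ} (ha : 0 < a) (hb : 0 ≤ b) (hc : 0 < c)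
    {μ : ℂ} (h : (c : ℂ) + μ * b + μ ^ 2 * a = 0) : μ.re < 0 ∨ b = 0 := by
  rcases hb.eq_or_lt with hb0 | hbpos
  · exact Or.inr hb0.symm
  left
  have hre := congrArg Complex.re h
  have him := congrArg Complex.im h
  simp only [Complex.add_re, Complex.mul_re, Complex.ofReal_re, Complex.ofReal_im, mul_zero,
    sub_zero, Complex.zero_re, Complex.add_im, Complex.mul_im, Complex.zero_im, sq] at hre him
  set x := μ.re with hx
  set y := μ.im with hy
  by_contra hxn
  have hx0 : 0 ≤ x := not_lt.mp hxn
  by_cases hy0 : y = 0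
  · rw [hy0] at hre
    simp only [mul_zero, sub_zero] at hre
    nlinarith [mul_nonneg hx0 hbpos.le, mul_nonneg (mul_nonneg hx0 hx0) ha.le]
  · -- imaginary part: `y (b + 2 a x) = 0`
    have h2 : y * (b + 2 * a * x) = 0 := by nlinarith [him]
    rcases mul_eq_zero.mp h2 with h3 | h3
    · exact hy0 h3
    · nlinarith [mul_nonneg hx0 ha.le]

/-- Cast of the bath multiplicity. [folklore] -/
theorem bathMult_ofReal (N : ℕ) (i : Fin N) : ((bathMult N i : ℝ) : ℂ) = bathMult N i := by
  unfold bathMult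
  split_ifs <;> simp

/-- The bath multiplicity is non-negative. [folklore] -/
theorem bathMult_nonneg (N : ℕ) (i : Fin N) : (0 : ℝ) ≤ bathMult N i := by
  simp only [bathMult]
  split_ifs <;> norm_num

/-- The bath multiplicity of the left end is at least one. [folklore] -/
theorem one_le_bathMult {N : ℕ} (i : Fin N) (hi : i.val = 0) : (1 : ℝ) ≤ bathMult N i := by
  simp only [bathMult, hi, if_true]
  split_ifs <;> norm_num

/-- For a complex vector, `u⋆ · u = ∑ |u_i|²`. [folklore] -/
theorem star_dotProduct_self_eq {N : ℕ} (u : Fin N → ℂ) :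
    star u ⬝ᵥ u = ((∑ i, Complex.normSq (u i) : ℝ) : ℂ) := by
  simp only [dotProduct, Pi.star_apply, Complex.star_def, Complex.ofReal_sum,
    Complex.normSq_eq_conj_mul_self]

/-- The Hermitian form of the friction matrix is real and non-negative:
`u⋆ Γ u = γ ∑ ([i=0]+[i=N-1]) |u_i|²`. [folklore] -/
theorem star_dotProduct_frictionMatrix_mulVec_eq (γ : ℝ) {N : ℕ} (u : Fin N → ℂ) :
    star u ⬝ᵥ (frictionMatrix (γ : ℂ) N *ᵥ u) =
      ((γ * ∑ i, bathMult N i * Complex.normSq (u i) : ℝ) : ℂ) := by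
  rw [star_dotProduct_frictionMatrix_mulVec]
  push_cast
  simp only [bathMult_ofReal, Complex.star_def, Complex.normSq_eq_conj_mul_self]

/-- The Hermitian form of the force matrix is real:
`u⋆ Φ u = ω₂ ∑ |u_i|² + ∑_{l = k+1} |u_l - u_k|²`. [folklore] -/
theorem star_dotProduct_forceMatrix_mulVec_eq (ω₂ : ℝ) {N : ℕ} (u : Fin N → ℂ) :
    star u ⬝ᵥ (forceMatrix (ω₂ : ℂ) N *ᵥ u) =
      ((ω₂ * ∑ i, Complex.normSq (u i) + ∑ k : Fin N, ∑ l : Fin N,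
        if l.val = k.val + 1 then Complex.normSq (u l - u k) else 0 : ℝ) : ℂ) := by
  rw [star_dotProduct_forceMatrix_mulVec]
  push_cast
  simp only [Complex.star_def, Complex.normSq_eq_conj_mul_self, map_sub]
  congr 1
  refine Finset.sum_congr rfl fun k _ => Finset.sum_congr rfl fun l _ => ?_
  split_ifs
  · rw [Complex.normSq_eq_conj_mul_self, map_sub]
  · simp

/-- **The drift matrix of the harmonic chain is Hurwitz** (`ω₂, γ > 0`, every `N`). If
`A (u, w) = μ (u, w)` then `w = μ u` and `Φ u + μ Γ u + μ² u = 0`; pairing with `u⋆` gives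
`c + b μ + a μ² = 0` with `a = |u|² > 0`, `b = u⋆Γu ≥ 0`, `c = u⋆Φu > 0`, whence `Re μ < 0`
unless `b = 0`; but `b = 0` forces `u_0 = 0` and then `u = 0` by propagation along the chain.
(The energy `½(|p|² + qᵀΦq)` is dissipated only through `p_0, p_{N-1}`, and no undamped mode
has a node at the bath site.) [folklore] -/
theorem isHurwitz_driftMatrix {ω₂ γ : ℝ} (hω : 0 < ω₂) (hγ : 0 < γ) (N : ℕ) :
    IsHurwitz (driftMatrix ω₂ γ N) := by
  intro μ v hv h
  rw [driftMatrix_map_ofReal] at h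
  set u : Fin N → ℂ := fun i => v (Sum.inl i) with hu
  set w : Fin N → ℂ := fun i => v (Sum.inr i) with hw
  have hv_eq : v = Sum.elim u w := by
    ext i
    rcases i with i | i <;> rfl
  rw [hv_eq, driftMatrix, fromBlocks_mulVec] at h
  have hl : ∀ i, w i = μ * u i := by
    intro i
    have := congrFun h (Sum.inl i)
    simpa using this
  have hwu : w = μ • u := funext fun i => by rw [hl i, Pi.smul_apply, smul_eq_mul]
  have hr : ∀ i, -(forceMatrix (ω₂ : ℂ) N *ᵥ u) i - (frictionMatrix (γ : ℂ) N *ᵥ w) i =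
      μ * w i := by
    intro i
    have := congrFun h (Sum.inr i)
    simpa [neg_mulVec, sub_eq_add_neg] using this
  -- the vector equation `Φ u + μ Γ u + μ² u = 0`
  have hvec : ∀ i, (forceMatrix (ω₂ : ℂ) N *ᵥ u) i + μ * (frictionMatrix (γ : ℂ) N *ᵥ u) i +
      μ ^ 2 * u i = 0 := by
    intro i
    have h1 := hr i
    rw [hwu, mulVec_smul, Pi.smul_apply, Pi.smul_apply, smul_eq_mul, smul_eq_mul] at h1
    linear_combination -h1
  -- `u ≠ 0`
  have hu0 : u ≠ 0 := by
    intro h0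
    apply hv
    rw [hv_eq, hwu, h0, smul_zero]
    ext i
    cases i <;> rfl
  -- pairing with `u⋆`
  set aR : ℝ := ∑ i, Complex.normSq (u i) with haR
  set bR : ℝ := γ * ∑ i, bathMult N i * Complex.normSq (u i) with hbR
  set cR : ℝ := ω₂ * ∑ i, Complex.normSq (u i) + ∑ k : Fin N, ∑ l : Fin N,
    if l.val = k.val + 1 then Complex.normSq (u l - u k) else 0 with hcR
  have haR_pos : 0 < aR := by
    obtain ⟨i, hi⟩ : ∃ i, u i ≠ 0 := by
      by_contra hall
      push Not at hall
      exact hu0 (funext hall)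
    exact lt_of_lt_of_le (Complex.normSq_pos.mpr hi)
      (Finset.single_le_sum (f := fun i => Complex.normSq (u i)) (fun j _ => Complex.normSq_nonneg _)
        (Finset.mem_univ i))
  have hbR_nn : 0 ≤ bR :=
    mul_nonneg hγ.le (Finset.sum_nonneg fun i _ => mul_nonneg (bathMult_nonneg N i)
      (Complex.normSq_nonneg _))
  have hcR_pos : 0 < cR := by
    have h2 : 0 ≤ ∑ k : Fin N, ∑ l : Fin N,
        if l.val = k.val + 1 then Complex.normSq (u l - u k) else 0 :=
      Finset.sum_nonneg fun k _ => Finset.sum_nonneg fun l _ => by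
        split_ifs
        · exact Complex.normSq_nonneg _
        · exact le_rfl
    have := mul_pos hω haR_pos
    simp only [hcR]
    linarith
  have hquad : (cR : ℂ) + μ * bR + μ ^ 2 * aR = 0 := by
    have hsum : ∑ i, star (u i) * ((forceMatrix (ω₂ : ℂ) N *ᵥ u) i +
        μ * (frictionMatrix (γ : ℂ) N *ᵥ u) i + μ ^ 2 * u i) = 0 :=
      Finset.sum_eq_zero fun i _ => by rw [hvec i, mul_zero]
    have e : ∑ i, star (u i) * ((forceMatrix (ω₂ : ℂ) N *ᵥ u) i +
        μ * (frictionMatrix (γ : ℂ) N *ᵥ u) i + μ ^ 2 * u i) =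
        star u ⬝ᵥ (forceMatrix (ω₂ : ℂ) N *ᵥ u) + μ * (star u ⬝ᵥ (frictionMatrix (γ : ℂ) N *ᵥ u)) +
          μ ^ 2 * (star u ⬝ᵥ u) := by
      simp only [dotProduct, Pi.star_apply, Finset.mul_sum, ← Finset.sum_add_distrib]
      refine Finset.sum_congr rfl fun i _ => ?_
      ring
    rw [e, star_dotProduct_forceMatrix_mulVec_eq, star_dotProduct_frictionMatrix_mulVec_eq,
      star_dotProduct_self_eq] at hsum
    exact hsum
  rcases re_neg_or_eq_zero_of_quadratic haR_pos hbR_nn hcR_pos hquad with hneg | hb0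
  · exact hneg
  · -- `b = 0`: the mode has a node at the left bath, hence vanishes identically
    exfalso
    apply hu0
    apply chain_propagation (ω₂ : ℂ) (γ : ℂ) μ u (fun a _ => hvec a)
    intro a ha
    have hterm : bathMult N a * Complex.normSq (u a) = 0 := by
      have hsum0 : ∑ i, bathMult N i * Complex.normSq (u i) = 0 := by
        have := hb0
        simp only [hbR] at this
        rcases mul_eq_zero.mp this with h1 | h1
        · exact absurd h1 hγ.ne'
        · exact h1
      exact (Finset.sum_eq_zero_iff_of_nonneg fun i _ =>
        mul_nonneg (bathMult_nonneg N i) (Complex.normSq_nonneg _)).mp hsum0 a (Finset.mem_univ a)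
    have h1 := one_le_bathMult a ha
    rcases mul_eq_zero.mp hterm with h2 | h2
    · linarith
    · exact Complex.normSq_eq_zero.mp h2

end Hurwitz

/-! ### The stationary covariance `C(T_L, T_R)` of the chain -/

section Covariance

variable {ω₂ γ : ℝ}

/-- **The stationary covariance of the harmonic chain** `pinnedChain ω₂ 0 0 γ` with `N` sites
between Langevin baths at temperatures `T_L, T_R`: the solution `C` of the Lyapunov equation
`A C + C Aᵀ + Σ = 0` (`A` the drift matrix, `Σ` the noise matrix), i.e. the covariance matrix
`⟨x xᵀ⟩` of the Gaussian stationary state (Rieder–Lebowitz–Lieb 1967; Dhar 2008, §3.1: "The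
solution of this equation gives the steady state correlation matrix `B` which completely
determines the steady state since we are dealing with a Gaussian process"). Junk value `0`
when `A` is not Hurwitz (`ω₂ ≤ 0` or `γ ≤ 0`). [cite: Dhar2008, §3.1] -/
def chainCov (ω₂ γ : ℝ) (N : ℕ) (T_L T_R : ℝ) : Matrix (Fin N ⊕ Fin N) (Fin N ⊕ Fin N) ℝ :=
  lyapSol (driftMatrix ω₂ γ N) (noiseMatrix γ N T_L T_R)

/-- The Lyapunov (stationarity) equation `A C + C Aᵀ + Σ = 0`. [Dhar 2008, §3.1]
[cite: Dhar2008, §3.1] -/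
theorem chainCov_lyapunov (hω : 0 < ω₂) (hγ : 0 < γ) (N : ℕ) (T_L T_R : ℝ) :
    driftMatrix ω₂ γ N * chainCov ω₂ γ N T_L T_R +
      chainCov ω₂ γ N T_L T_R * (driftMatrix ω₂ γ N)ᵀ + noiseMatrix γ N T_L T_R = 0 :=
  (isHurwitz_driftMatrix hω hγ N).lyapSol_eq _

/-- Uniqueness of the stationary covariance: any solution of the Lyapunov equation is
`chainCov`. [folklore] -/
theorem eq_chainCov (hω : 0 < ω₂) (hγ : 0 < γ) {N : ℕ} {T_L T_R : ℝ}
    {X : Matrix (Fin N ⊕ Fin N) (Fin N ⊕ Fin N) ℝ}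
    (hX : driftMatrix ω₂ γ N * X + X * (driftMatrix ω₂ γ N)ᵀ + noiseMatrix γ N T_L T_R = 0) :
    X = chainCov ω₂ γ N T_L T_R :=
  (isHurwitz_driftMatrix hω hγ N).eq_lyapSol hX

/-- The stationary covariance is symmetric. [folklore] -/
theorem chainCov_transpose (hω : 0 < ω₂) (hγ : 0 < γ) (N : ℕ) (T_L T_R : ℝ) :
    (chainCov ω₂ γ N T_L T_R)ᵀ = chainCov ω₂ γ N T_L T_R :=
  (isHurwitz_driftMatrix hω hγ N).lyapSol_transpose_of_symm (noiseMatrix_transpose γ N T_L T_R)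

/-- The noise matrix is linear in the bath temperatures. [folklore] -/
theorem noiseMatrix_eq_add (γ : ℝ) (N : ℕ) (T_L T_R : ℝ) :
    noiseMatrix γ N T_L T_R = T_L • noiseMatrix γ N 1 0 + T_R • noiseMatrix γ N 0 1 := by
  ext a b
  rcases a with i | i <;> rcases b with j | j
  · simp [noiseMatrix]
  · simp [noiseMatrix]
  · simp [noiseMatrix]
  · simp only [noiseMatrix, fromBlocks_apply₂₂, Matrix.add_apply, Matrix.smul_apply, diagonal_apply,
      smul_eq_mul, bathTemp]
    split_ifs <;> ring

/-- **Linearity in the temperatures**: `C(T_L, T_R) = T_L C(1, 0) + T_R C(0, 1)`.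
[Bonetto–Lebowitz–Lukkarinen 2004, eq. (2.13) ("`B_{ij} = ∑_r B^{(r)}_{ij} T_r`")] [folklore] -/
theorem chainCov_eq_add (hω : 0 < ω₂) (hγ : 0 < γ) (N : ℕ) (T_L T_R : ℝ) :
    chainCov ω₂ γ N T_L T_R = T_L • chainCov ω₂ γ N 1 0 + T_R • chainCov ω₂ γ N 0 1 := by
  have hA := isHurwitz_driftMatrix hω hγ N
  rw [chainCov, noiseMatrix_eq_add, hA.lyapSol_add, hA.lyapSol_smul, hA.lyapSol_smul]
  rfl

/-! ### The equilibrium (Gibbs) covariance -/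

/-- `v ⬝ᵥ v > 0` for a non-zero real vector. [folklore] -/
theorem dotProduct_self_pos_of_ne_zero {n : Type*} [Fintype n] {v : n → ℝ} (hv : v ≠ 0) :
    0 < v ⬝ᵥ v :=
  lt_of_le_of_ne (Finset.sum_nonneg fun i _ => mul_self_nonneg (v i))
    (Ne.symm fun h => hv (dotProduct_self_eq_zero.mp h))

/-- The force matrix is positive definite for `ω₂ > 0`:
`qᵀ Φ q = ω₂ |q|² + ∑ (q_{k+1} - q_k)² ≥ ω₂ |q|²`. [folklore] -/
theorem forceMatrix_posDef (hω : 0 < ω₂) (N : ℕ) : (forceMatrix ω₂ N).PosDef := by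
  refine Matrix.PosDef.of_dotProduct_mulVec_pos ?_ fun x hx => ?_
  · rw [Matrix.IsHermitian, conjTranspose_eq_transpose_of_trivial, forceMatrix_transpose]
  · rw [star_dotProduct_forceMatrix_mulVec]
    simp only [star_trivial]
    have h1 : 0 < ∑ a, x a * x a := dotProduct_self_pos_of_ne_zero hx
    have h2 : 0 ≤ ∑ k : Fin N, ∑ l : Fin N,
        if l.val = k.val + 1 then (x l - x k) * (x l - x k) else 0 :=
      Finset.sum_nonneg fun k _ => Finset.sum_nonneg fun l _ => by
        split_ifs
        · exact mul_self_nonneg _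
        · exact le_rfl
    nlinarith [mul_pos hω h1]

/-- The equilibrium covariance at unit temperature, `G = [[Φ⁻¹, 0], [0, 1]]` (covariance of
the Gibbs measure `∝ e^{-H}`, `H = (pᵀp + qᵀΦq)/2`). [Bonetto–Lebowitz–Lukkarinen 2004, §2
("`S_eq = T diag(Φ⁻¹, 1)` … the stationary measure is the Gibbs measure at temperature `T`")]
[folklore] -/
def gibbsCov (ω₂ : ℝ) (N : ℕ) : Matrix (Fin N ⊕ Fin N) (Fin N ⊕ Fin N) ℝ :=
  Matrix.fromBlocks (forceMatrix ω₂ N)⁻¹ 0 0 1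

/-- The equilibrium covariance is positive definite. [folklore] -/
theorem gibbsCov_posDef (hω : 0 < ω₂) (N : ℕ) : (gibbsCov ω₂ N).PosDef := by
  have hΦ := (forceMatrix_posDef hω N).inv
  have hΦT : ((forceMatrix ω₂ N)⁻¹)ᵀ = (forceMatrix ω₂ N)⁻¹ := by
    rw [transpose_nonsing_inv, forceMatrix_transpose]
  refine Matrix.PosDef.of_dotProduct_mulVec_pos ?_ fun x hx => ?_
  · rw [Matrix.IsHermitian, conjTranspose_eq_transpose_of_trivial, gibbsCov, fromBlocks_transpose,
      transpose_zero, transpose_one, hΦT]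
  · rw [star_trivial]
    set u : Fin N → ℝ := fun i => x (Sum.inl i)
    set w : Fin N → ℝ := fun i => x (Sum.inr i)
    have hx_eq : x = Sum.elim u w := by
      ext i; rcases i with i | i <;> rfl
    rw [hx_eq, gibbsCov, fromBlocks_mulVec, sumElim_dotProduct_sumElim]
    simp only [Sum.elim_comp_inl, Sum.elim_comp_inr, zero_mulVec, add_zero, zero_add, one_mulVec]
    by_cases hu : u = 0
    · have hw : w ≠ 0 := by
        intro hw
        apply hx
        rw [hx_eq, hu, hw]
        ext i; cases i <;> rfl
      rw [hu, zero_dotProduct, zero_add]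
      exact dotProduct_self_pos_of_ne_zero hw
    · have h1 := hΦ.dotProduct_mulVec_pos hu
      rw [star_trivial] at h1
      have h2 : 0 ≤ w ⬝ᵥ w := Finset.sum_nonneg fun i _ => mul_self_nonneg (w i)
      linarith

/-- `bathTemp N T T = T · bathMult N`. [folklore] -/
theorem bathTemp_self (N : ℕ) (T : ℝ) (i : Fin N) : bathTemp N T T i = T * bathMult N i := by
  simp only [bathTemp, bathMult]
  split_ifs <;> ring

/-- **Equal temperatures: the Gibbs state.** `C(T, T) = T · [[Φ⁻¹, 0], [0, 1]]`, the covariance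
of the Gibbs measure at temperature `T` (fluctuation–dissipation: `A G + G Aᵀ = -[[0,0],[0,2Γ]]`
is exactly compensated by the noise `2TΓ`). [Bonetto–Lebowitz–Lukkarinen 2004, §2;
Bonetto–Lebowitz–Rey-Bellet 2000, §4.1] [folklore] -/
theorem chainCov_self (hω : 0 < ω₂) (hγ : 0 < γ) (N : ℕ) (T : ℝ) :
    chainCov ω₂ γ N T T = T • gibbsCov ω₂ N := by
  symm
  apply eq_chainCov hω hγ
  have hunit : IsUnit (forceMatrix ω₂ N).det :=
    (isUnit_iff_isUnit_det _).mp (forceMatrix_posDef hω N).isUnit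
  have h1 : forceMatrix ω₂ N * (forceMatrix ω₂ N)⁻¹ = 1 := mul_nonsing_inv _ hunit
  have h2 : (forceMatrix ω₂ N)⁻¹ * forceMatrix ω₂ N = 1 := nonsing_inv_mul _ hunit
  have hAG : driftMatrix ω₂ γ N * gibbsCov ω₂ N = Matrix.fromBlocks 0 1 (-1) (-frictionMatrix γ N) := by
    rw [driftMatrix, gibbsCov, fromBlocks_multiply]
    simp [h1]
  have hGA : gibbsCov ω₂ N * (driftMatrix ω₂ γ N)ᵀ =
      Matrix.fromBlocks 0 (-1) 1 (-frictionMatrix γ N) := by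
    rw [driftMatrix_transpose, gibbsCov, fromBlocks_multiply]
    simp [h2]
  rw [Matrix.mul_smul, Matrix.smul_mul, hAG, hGA, ← smul_add, fromBlocks_add, noiseMatrix,
    fromBlocks_smul, fromBlocks_add, ← fromBlocks_zero, fromBlocks_inj]
  refine ⟨by simp, by simp, by simp, ?_⟩
  ext i j
  simp only [Matrix.add_apply, Matrix.smul_apply, Matrix.neg_apply, diagonal_apply, frictionMatrix,
    bathTemp_self, smul_eq_mul, Matrix.zero_apply]
  split_ifs <;> ring

/-- `C(1, 0) + C(0, 1) = G`: the two one-bath covariances add up to the unit-temperature Gibbs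
covariance. [folklore] -/
theorem chainCov_one_zero_add (hω : 0 < ω₂) (hγ : 0 < γ) (N : ℕ) :
    chainCov ω₂ γ N 1 0 + chainCov ω₂ γ N 0 1 = gibbsCov ω₂ N := by
  have h := chainCov_eq_add hω hγ N 1 1
  rw [one_smul, one_smul, chainCov_self hω hγ N 1, one_smul] at h
  exact h.symm

/-! ### Non-degeneracy: `C(T_L, T_R)` is positive definite for `T_L, T_R > 0` -/

/-- The noise matrix over `ℂ` is the complexification of the real one. [folklore] -/
theorem noiseMatrix_map_ofReal (γ : ℝ) (N : ℕ) (T_L T_R : ℝ) :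
    (noiseMatrix γ N T_L T_R).map (algebraMap ℝ ℂ) =
      Matrix.fromBlocks 0 0 0 (Matrix.diagonal fun i => ((2 * γ * bathTemp N T_L T_R i : ℝ) : ℂ)) := by
  rw [noiseMatrix, fromBlocks_map, Matrix.map_zero _ (map_zero _)]
  congr 1
  ext i j
  simp only [map_apply, diagonal_apply, Complex.coe_algebraMap]
  split_ifs <;> simp

/-- **Controllability: the stationary covariance has trivial kernel as soon as the left bath is
active** (`T_L > 0`, `T_R ≥ 0`). If `C v = 0` on a non-zero subspace `K`, then `K` is
`Aᵀ`-invariant and killed by the noise (`v⋆ Σ v = -v⋆(AC + CAᵀ)v = 0`), so it contains a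
complex eigenvector of `Aᵀ` with vanishing `p_0`-component; the eigenvector equation is again
`Φ w + μ Γ w + μ² w = 0` for its momentum part, which then vanishes by propagation along the
chain. [folklore] -/
theorem chainCov_mulVec_eq_zero (hω : 0 < ω₂) (hγ : 0 < γ) {N : ℕ} {T_L T_R : ℝ} (hL : 0 < T_L)
    (hR : 0 ≤ T_R) {x : Fin N ⊕ Fin N → ℝ} (hx : chainCov ω₂ γ N T_L T_R *ᵥ x = 0) : x = 0 := by
  by_contra hx0
  -- notation and complexification
  set C := chainCov ω₂ γ N T_L T_R with hC
  set f := algebraMap ℝ ℂ with hf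
  set φ : Matrix (Fin N ⊕ Fin N) (Fin N ⊕ Fin N) ℝ →+* Matrix (Fin N ⊕ Fin N) (Fin N ⊕ Fin N) ℂ :=
    f.mapMatrix with hφ
  set Cc := φ C with hCc
  set Ac := φ (driftMatrix ω₂ γ N) with hAc
  set Sc := φ (noiseMatrix γ N T_L T_R) with hSc
  have hCc' : Cc = C.map f := rfl
  have hAc' : Ac = driftMatrix (ω₂ : ℂ) (γ : ℂ) N := by
    rw [hAc, RingHom.mapMatrix_apply, hf, driftMatrix_map_ofReal]
  have hSc' : Sc = Matrix.fromBlocks 0 0 0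
      (Matrix.diagonal fun i => ((2 * γ * bathTemp N T_L T_R i : ℝ) : ℂ)) := by
    rw [hSc, RingHom.mapMatrix_apply, hf, noiseMatrix_map_ofReal]
  have hCT : Cᵀ = C := chainCov_transpose hω hγ N T_L T_R
  have hsym : ∀ i j, C j i = C i j := fun i j => by
    have := congrFun (congrFun hCT i) j
    rwa [transpose_apply] at this
  have hCcH : Ccᴴ = Cc := by
    ext i j
    simp only [conjTranspose_apply, hCc', map_apply, hsym i j, hf, Complex.coe_algebraMap,
      Complex.star_def, Complex.conj_ofReal]
  have hlyap : Ac * Cc + Cc * Acᵀ + Sc = 0 := by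
    have h := congrArg φ (chainCov_lyapunov hω hγ N T_L T_R)
    rw [map_add, map_add, map_mul, map_mul, map_zero] at h
    have hT : φ (driftMatrix ω₂ γ N)ᵀ = Acᵀ := by
      rw [hAc, RingHom.mapMatrix_apply, RingHom.mapMatrix_apply, transpose_map]
    rw [hT] at h
    exact h
  -- the kernel of `Cc`
  set K : Submodule ℂ (Fin N ⊕ Fin N → ℂ) := LinearMap.ker (Matrix.toLin' Cc) with hK
  have hmemK : ∀ w, w ∈ K ↔ Cc *ᵥ w = 0 := fun w => by
    rw [hK, LinearMap.mem_ker, Matrix.toLin'_apply]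
  -- the real vector `x` gives a non-zero element of `K`
  have hxK : (f ∘ x) ∈ K := by
    rw [hmemK]
    funext i
    have := RingHom.map_mulVec f C x i
    rw [← hCc'] at this
    rw [← this, hx]
    simp [hf]
  have hxne : (f ∘ x) ≠ 0 := by
    intro h0
    apply hx0
    funext i
    have := congrFun h0 i
    simpa [hf] using this
  have hKne : K ≠ ⊥ := fun hbot => hxne ((Submodule.mem_bot ℂ).mp (hbot ▸ hxK))
  -- for `w ∈ K`: `w⋆ Σ w = 0`, hence `Σ w = 0` and the `p_0`-component of `w` vanishes
  have hdiag_nn : ∀ i : Fin N, 0 ≤ 2 * γ * bathTemp N T_L T_R i := by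
    intro i
    simp only [bathTemp]
    split_ifs <;> nlinarith
  have hnoise : ∀ w ∈ K, ∀ i : Fin N,
      (2 * γ * bathTemp N T_L T_R i) * Complex.normSq (w (Sum.inr i)) = 0 := by
    intro w hw
    rw [hmemK] at hw
    -- `w⋆ C z = 0` for every `z`
    have hwC : ∀ z, star w ⬝ᵥ (Cc *ᵥ z) = 0 := by
      intro z
      rw [dotProduct_mulVec, ← star_star (star w ᵥ* Cc), star_vecMul, hCcH, star_star, hw,
        star_zero, zero_dotProduct]
    have h0 : star w ⬝ᵥ (Sc *ᵥ w) = 0 := by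
      have := congrArg (fun M => star w ⬝ᵥ (M *ᵥ w)) hlyap
      simp only [add_mulVec, dotProduct_add, zero_mulVec, dotProduct_zero, ← mulVec_mulVec, hw,
        mulVec_zero, hwC] at this
      simpa using this
    rw [hSc', fromBlocks_mulVec] at h0
    have hsplit : w = Sum.elim (fun i => w (Sum.inl i)) (fun i => w (Sum.inr i)) := by
      ext i; rcases i with i | i <;> rfl
    rw [hsplit] at h0
    simp only [Sum.elim_comp_inl, Sum.elim_comp_inr, zero_mulVec, zero_add] at h0
    rw [show star (Sum.elim (fun i => w (Sum.inl i)) fun i => w (Sum.inr i)) =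
        Sum.elim (star fun i => w (Sum.inl i)) (star fun i => w (Sum.inr i)) from by
          ext i; rcases i with i | i <;> rfl,
      sumElim_dotProduct_sumElim, dotProduct_zero, zero_add] at h0
    simp only [dotProduct, Pi.star_apply, Complex.star_def, mulVec_diagonal] at h0
    have h0' : ∑ i : Fin N, (((2 * γ * bathTemp N T_L T_R i) * Complex.normSq (w (Sum.inr i)) : ℝ)
        : ℂ) = 0 := by
      rw [← h0]
      push_cast
      refine Finset.sum_congr rfl fun i _ => ?_
      rw [Complex.normSq_eq_conj_mul_self]
      ring
    have h0'' : ∑ i : Fin N, (2 * γ * bathTemp N T_L T_R i) * Complex.normSq (w (Sum.inr i)) = 0 := by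
      exact_mod_cast h0'
    exact fun i => ((Finset.sum_eq_zero_iff_of_nonneg fun i _ =>
      mul_nonneg (hdiag_nn i) (Complex.normSq_nonneg _)).mp h0'') i (Finset.mem_univ i)
  have hSw : ∀ w ∈ K, Sc *ᵥ w = 0 := by
    intro w hw
    have hsplit : w = Sum.elim (fun i => w (Sum.inl i)) (fun i => w (Sum.inr i)) := by
      ext i; rcases i with i | i <;> rfl
    rw [hSc', hsplit, fromBlocks_mulVec]
    simp only [Sum.elim_comp_inl, Sum.elim_comp_inr, zero_mulVec, zero_add]
    ext i
    rcases i with i | i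
    · rfl
    · simp only [Sum.elim_inr, Pi.zero_apply, mulVec_diagonal]
      rcases mul_eq_zero.mp (hnoise w hw i) with h1 | h1
      · rw [h1]; simp
      · rw [Complex.normSq_eq_zero.mp h1, mul_zero]
  have hleft : ∀ w ∈ K, ∀ i : Fin N, i.val = 0 → w (Sum.inr i) = 0 := by
    intro w hw i hi
    have h := hnoise w hw i
    have hpos : 0 < 2 * γ * bathTemp N T_L T_R i := by
      simp only [bathTemp, hi, if_true]
      split_ifs <;> nlinarith
    rcases mul_eq_zero.mp h with h1 | h1
    · exact absurd h1 hpos.ne'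
    · exact Complex.normSq_eq_zero.mp h1
  -- `K` is invariant under `Acᵀ`
  have hinv : ∀ w ∈ K, Matrix.toLin' Acᵀ w ∈ K := by
    intro w hw
    have hw' := (hmemK w).mp hw
    rw [hmemK, Matrix.toLin'_apply, mulVec_mulVec]
    have := congrArg (fun M => M *ᵥ w) hlyap
    simp only [add_mulVec, zero_mulVec, ← mulVec_mulVec, hw', mulVec_zero, zero_add, hSw w hw,
      add_zero] at this
    rw [mulVec_mulVec] at this
    exact this
  -- an eigenvector of `Acᵀ` inside `K`
  haveI : Nontrivial K := Submodule.nontrivial_iff_ne_bot.mpr hKne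
  set g : Module.End ℂ K := (Matrix.toLin' Acᵀ).restrict hinv with hg
  obtain ⟨c, hc⟩ := Module.End.exists_eigenvalue g
  obtain ⟨⟨k, hkK⟩, hk⟩ := hc.exists_hasEigenvector
  have hk0 : k ≠ 0 := fun h => hk.2 (Subtype.ext h)
  have hkeig : Acᵀ *ᵥ k = c • k := by
    have h := hk.apply_eq_smul
    have h' := congrArg Subtype.val h
    rw [hg, LinearMap.coe_restrict_apply, Matrix.toLin'_apply] at h'
    exact h'
  -- block form of the eigenvector equation
  set u : Fin N → ℂ := fun i => k (Sum.inl i) with hu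
  set w : Fin N → ℂ := fun i => k (Sum.inr i) with hw
  have hk_eq : k = Sum.elim u w := by
    ext i; rcases i with i | i <;> rfl
  rw [hAc', driftMatrix_transpose, hk_eq, fromBlocks_mulVec] at hkeig
  have h1 : ∀ i, -(forceMatrix (ω₂ : ℂ) N *ᵥ w) i = c * u i := by
    intro i
    have := congrFun hkeig (Sum.inl i)
    simpa [neg_mulVec] using this
  have h2 : ∀ i, u i - (frictionMatrix (γ : ℂ) N *ᵥ w) i = c * w i := by
    intro i
    have := congrFun hkeig (Sum.inr i)
    simpa [neg_mulVec, sub_eq_add_neg] using this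
  have hvec : ∀ i, (forceMatrix (ω₂ : ℂ) N *ᵥ w) i + c * (frictionMatrix (γ : ℂ) N *ᵥ w) i +
      c ^ 2 * w i = 0 := by
    intro i
    have e1 := h1 i
    have e2 := h2 i
    have e3 : u i = c * w i + (frictionMatrix (γ : ℂ) N *ᵥ w) i := by linear_combination e2
    rw [e3] at e1
    linear_combination -e1
  have hw0 : w = 0 := chain_propagation (ω₂ : ℂ) (γ : ℂ) c w (fun a _ => hvec a)
    (fun a ha => hleft k hkK a ha)
  have hu0 : u = 0 := by
    funext i
    have e2 := h2 i
    rw [hw0, mulVec_zero] at e2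
    simp only [Pi.zero_apply, sub_zero, mul_zero] at e2
    exact e2
  apply hk0
  rw [hk_eq, hu0, hw0]
  ext i; cases i <;> rfl

/-- **The stationary covariance is positive definite** for `T_L, T_R > 0` (so the stationary
Gaussian state has a density). Along the segment of temperatures from `(T_L, T_L)` (Gibbs,
positive definite) to `(T_L, T_R)` the covariances are symmetric with trivial kernel, so
positivity propagates (`posDef_of_segment`). [Rieder–Lebowitz–Lieb 1967 (Gaussian stationary
state with density); Dhar 2008, §3.1 eq. `P({q}) ∝ e^{-½ qᵀB⁻¹q}`] [folklore] -/
theorem chainCov_posDef (hω : 0 < ω₂) (hγ : 0 < γ) (N : ℕ) {T_L T_R : ℝ} (hL : 0 < T_L)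
    (hR : 0 < T_R) : (chainCov ω₂ γ N T_L T_R).PosDef := by
  have hseg : ∀ s : ℝ, chainCov ω₂ γ N T_L T_L + s • (chainCov ω₂ γ N T_L T_R - chainCov ω₂ γ N T_L T_L) =
      chainCov ω₂ γ N T_L ((1 - s) * T_L + s * T_R) := by
    intro s
    rw [chainCov_eq_add hω hγ N T_L T_L, chainCov_eq_add hω hγ N T_L T_R,
      chainCov_eq_add hω hγ N T_L ((1 - s) * T_L + s * T_R)]
    module
  refine posDef_of_segment (K₀ := chainCov ω₂ γ N T_L T_L) ?_ (chainCov_transpose hω hγ N T_L T_R)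
    fun s hs v hv => ?_
  · rw [chainCov_self hω hγ N T_L]
    exact (gibbsCov_posDef hω N).smul hL
  · rw [hseg s] at hv
    refine chainCov_mulVec_eq_zero hω hγ hL ?_ hv
    have h1 : 0 ≤ 1 - s := by linarith [hs.2]
    nlinarith [hs.1, h1, hL, hR]

end Covariance

/-! ### Block identities: position–momentum covariances and the bond currents -/

section Currents

variable {ω₂ γ : ℝ}

/-- Rows `inl` of `A X`: `(A X)_{q_i, b} = X_{p_i, b}`. [folklore] -/
theorem driftMatrix_mul_apply_inl {N : ℕ} (X : Matrix (Fin N ⊕ Fin N) (Fin N ⊕ Fin N) ℝ)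
    (i : Fin N) (b : Fin N ⊕ Fin N) :
    (driftMatrix ω₂ γ N * X) (Sum.inl i) b = X (Sum.inr i) b := by
  simp [driftMatrix, Matrix.mul_apply, Fintype.sum_sum_type, fromBlocks_apply₁₁, fromBlocks_apply₁₂,
    one_apply]

/-- Columns `inl` of `X Aᵀ`: `(X Aᵀ)_{a, q_j} = X_{a, p_j}`. [folklore] -/
theorem mul_driftMatrix_transpose_apply_inl {N : ℕ} (X : Matrix (Fin N ⊕ Fin N) (Fin N ⊕ Fin N) ℝ)
    (a : Fin N ⊕ Fin N) (j : Fin N) :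
    (X * (driftMatrix ω₂ γ N)ᵀ) a (Sum.inl j) = X a (Sum.inr j) := by
  simp [driftMatrix, Matrix.mul_apply, Fintype.sum_sum_type, fromBlocks_apply₁₁, fromBlocks_apply₁₂,
    one_apply]

/-- Rows `inr` of `A X`: `(A X)_{p_i, b} = -∑_k Φ_{ik} X_{q_k, b} - γ([i=0]+[i=N-1]) X_{p_i, b}`.
[folklore] -/
theorem driftMatrix_mul_apply_inr {N : ℕ} (X : Matrix (Fin N ⊕ Fin N) (Fin N ⊕ Fin N) ℝ)
    (i : Fin N) (b : Fin N ⊕ Fin N) :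
    (driftMatrix ω₂ γ N * X) (Sum.inr i) b =
      -(∑ k, forceMatrix ω₂ N i k * X (Sum.inl k) b) - γ * bathMult N i * X (Sum.inr i) b := by
  simp only [driftMatrix, Matrix.mul_apply, Fintype.sum_sum_type, fromBlocks_apply₂₁,
    fromBlocks_apply₂₂, Matrix.neg_apply, frictionMatrix, diagonal_apply, neg_mul,
    Finset.sum_neg_distrib, ite_mul, zero_mul, Finset.sum_ite_eq, Finset.mem_univ, if_true]
  ring

/-- Columns `inr` of `X Aᵀ`: `(X Aᵀ)_{a, p_j} = -∑_k X_{a, q_k} Φ_{jk} - γ([j=0]+[j=N-1]) X_{a, p_j}`.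
[folklore] -/
theorem mul_driftMatrix_transpose_apply_inr {N : ℕ} (X : Matrix (Fin N ⊕ Fin N) (Fin N ⊕ Fin N) ℝ)
    (a : Fin N ⊕ Fin N) (j : Fin N) :
    (X * (driftMatrix ω₂ γ N)ᵀ) a (Sum.inr j) =
      -(∑ k, X a (Sum.inl k) * forceMatrix ω₂ N j k) - γ * bathMult N j * X a (Sum.inr j) := by
  simp only [driftMatrix, Matrix.mul_apply, Fintype.sum_sum_type, transpose_apply, fromBlocks_apply₂₁,
    fromBlocks_apply₂₂, Matrix.neg_apply, frictionMatrix, diagonal_apply, mul_neg,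
    Finset.sum_neg_distrib, mul_ite, mul_zero, Finset.sum_ite_eq, Finset.mem_univ, if_true]
  ring

/-- **`⟨q_i p_j⟩` is antisymmetric**: the `(q_i, q_j)` entry of the Lyapunov equation reads
`C_{p_i q_j} + C_{q_i p_j} = 0`, i.e. `⟨q_j p_i⟩ = -⟨q_i p_j⟩`. [Dhar 2008, §3.1 ("from Eq.
(3.1:eq1) we get the identity `⟨x_l p_n/m_n⟩ = -⟨x_n p_l/m_l⟩`")] [cite: Dhar2008, §3.1] -/
theorem chainCov_inl_inr_antisymm (hω : 0 < ω₂) (hγ : 0 < γ) {N : ℕ} (T_L T_R : ℝ)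
    (i j : Fin N) :
    chainCov ω₂ γ N T_L T_R (Sum.inl i) (Sum.inr j) =
      -chainCov ω₂ γ N T_L T_R (Sum.inl j) (Sum.inr i) := by
  have h := congrFun (congrFun (chainCov_lyapunov hω hγ N T_L T_R) (Sum.inl i)) (Sum.inl j)
  rw [Matrix.add_apply, Matrix.add_apply, driftMatrix_mul_apply_inl,
    mul_driftMatrix_transpose_apply_inl] at h
  have hsym : chainCov ω₂ γ N T_L T_R (Sum.inr i) (Sum.inl j) =
      chainCov ω₂ γ N T_L T_R (Sum.inl j) (Sum.inr i) := by
    rw [← chainCov_transpose hω hγ N T_L T_R, transpose_apply, chainCov_transpose hω hγ N T_L T_R]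
  have h0 : noiseMatrix γ N T_L T_R (Sum.inl i) (Sum.inl j) = 0 := by simp [noiseMatrix]
  rw [hsym, h0, add_zero, Matrix.zero_apply] at h
  linarith

/-- `⟨q_i p_i⟩ = 0`. [Dhar 2008, §3.1 ("Thus `⟨x_l p_l⟩ = 0`")] [cite: Dhar2008, §3.1] -/
theorem chainCov_inl_inr_self (hω : 0 < ω₂) (hγ : 0 < γ) {N : ℕ} (T_L T_R : ℝ) (i : Fin N) :
    chainCov ω₂ γ N T_L T_R (Sum.inl i) (Sum.inr i) = 0 := by
  have h := chainCov_inl_inr_antisymm hω hγ T_L T_R i i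
  linarith

/-- **Energy conservation at an interior site.** The `(p_i, p_i)` entry of the Lyapunov equation
at a site `i` not coupled to a bath (`0 < i < N-1`) gives `(Φ Z)_{ii} = 0` with
`Z_{kl} = ⟨q_k p_l⟩`, i.e. `⟨q_{i-1} p_i⟩ = ⟨q_i p_{i+1}⟩`: the mean energy current into site
`i` equals the mean current out of it. [Dhar 2008, §3.1 (eq. "`∑_n ⟨(Φ_ln x_n) p_l/m_l⟩ =
γ_l (T_l^B - T_l)/m_l`", "an energy-conservation equation")] [cite: Dhar2008, §3.1] -/
theorem chainCov_bond_succ (hω : 0 < ω₂) (hγ : 0 < γ) {N : ℕ} (T_L T_R : ℝ) (i : Fin N)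
    (h0 : 0 < i.val) (h1 : i.val + 1 < N) :
    chainCov ω₂ γ N T_L T_R (Sum.inl ⟨i.val - 1, by omega⟩) (Sum.inr i) =
      chainCov ω₂ γ N T_L T_R (Sum.inl i) (Sum.inr ⟨i.val + 1, h1⟩) := by
  have hsym : ∀ k, chainCov ω₂ γ N T_L T_R (Sum.inr i) (Sum.inl k) =
      chainCov ω₂ γ N T_L T_R (Sum.inl k) (Sum.inr i) := fun k => by
    have := congrFun (congrFun (chainCov_transpose hω hγ N T_L T_R) (Sum.inl k)) (Sum.inr i)
    rwa [transpose_apply] at this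
  have h := congrFun (congrFun (chainCov_lyapunov hω hγ N T_L T_R) (Sum.inr i)) (Sum.inr i)
  rw [Matrix.add_apply, Matrix.add_apply, driftMatrix_mul_apply_inr,
    mul_driftMatrix_transpose_apply_inr, Matrix.zero_apply] at h
  have hbm : (bathMult N i : ℝ) = 0 := by
    simp only [bathMult]
    rw [if_neg (by omega), if_neg (by omega), add_zero]
  have hbt : noiseMatrix γ N T_L T_R (Sum.inr i) (Sum.inr i) = 0 := by
    simp only [noiseMatrix, fromBlocks_apply₂₂, diagonal_apply_eq, bathTemp]
    rw [if_neg (by omega), if_neg (by omega)]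
    ring
  simp only [hbm, hbt, mul_zero, zero_mul, sub_zero, add_zero, hsym] at h
  -- `h : -(∑ k, Φ i k * Z k i) + -(∑ k, Z k i * Φ i k) = 0`
  have hΦZ : (forceMatrix ω₂ N *ᵥ fun k => chainCov ω₂ γ N T_L T_R (Sum.inl k) (Sum.inr i)) i = 0 := by
    have e : ∑ k, chainCov ω₂ γ N T_L T_R (Sum.inl k) (Sum.inr i) * forceMatrix ω₂ N i k =
        ∑ k, forceMatrix ω₂ N i k * chainCov ω₂ γ N T_L T_R (Sum.inl k) (Sum.inr i) :=
      Finset.sum_congr rfl fun k _ => mul_comm _ _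
    rw [e] at h
    simp only [mulVec, dotProduct]
    linarith
  rw [forceMatrix_mulVec_apply_eq, dif_pos h0, dif_pos h1] at hΦZ
  have hself := chainCov_inl_inr_self hω hγ T_L T_R i
  have hanti := chainCov_inl_inr_antisymm hω hγ T_L T_R ⟨i.val + 1, h1⟩ i
  simp only [hself, mul_zero, zero_sub, sub_zero, zero_add] at hΦZ
  -- `hΦZ : -Z (i-1) i - Z (i+1) i = 0`
  linarith

/-- The same identity, shifted: `⟨q_i p_{i+1}⟩ = ⟨q_{i+1} p_{i+2}⟩`. [folklore] -/
theorem chainCov_bond_succ' (hω : 0 < ω₂) (hγ : 0 < γ) {N : ℕ} (T_L T_R : ℝ) (n : ℕ)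
    (h2 : n + 2 < N) :
    chainCov ω₂ γ N T_L T_R (Sum.inl ⟨n, by omega⟩) (Sum.inr ⟨n + 1, by omega⟩) =
      chainCov ω₂ γ N T_L T_R (Sum.inl ⟨n + 1, by omega⟩) (Sum.inr ⟨n + 2, h2⟩) :=
  chainCov_bond_succ hω hγ T_L T_R ⟨n + 1, by omega⟩ (by simp) (by simp; omega)

/-- **All bonds carry the same mean current**: `⟨q_n p_{n+1}⟩ = ⟨q_0 p_1⟩` for every bond
`(n, n+1)`. [Bonetto–Lebowitz–Rey-Bellet 2000, §5.2 ("in the stationary state the heat flux is the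
same through every bond")] [folklore] -/
theorem chainCov_bond_eq (hω : 0 < ω₂) (hγ : 0 < γ) {N : ℕ} (T_L T_R : ℝ) (n : ℕ)
    (hn : n + 1 < N) :
    chainCov ω₂ γ N T_L T_R (Sum.inl ⟨n, by omega⟩) (Sum.inr ⟨n + 1, hn⟩) =
      chainCov ω₂ γ N T_L T_R (Sum.inl ⟨0, by omega⟩) (Sum.inr ⟨1, by omega⟩) := by
  induction n with
  | zero => rfl
  | succ n ih => rw [← chainCov_bond_succ' hω hγ T_L T_R n hn, ih (by omega)]

/-- **The flux coefficient `c_N`** of the harmonic chain: the mean bond current `⟨q_0 p_1⟩` in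
the stationary state with bath temperatures `(T_L, T_R) = (1, 0)` (junk value `0` for
`N ≤ 1`, where there is no bond). By linearity and the vanishing of the current at equilibrium,
the mean current of every bond at temperatures `(T_L, T_R)` is `c_N (T_L - T_R)`
(`chainCov_bond_eq_fluxCoeff`). Its `N → ∞` limit is the subject of Rieder–Lebowitz–Lieb 1967
and Nakazawa 1970 (Roy–Dhar 2008, eq. (2.8)). [Dhar 2008, §3.1 ("The energy current between
two sites is given by `J_{n→l} = -⟨(Φ_ln x_n) p_l/m_l⟩`", here `Φ_{i,i+1} = -1`)]
[cite: Dhar2008, §3.1] -/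
def fluxCoeff (ω₂ γ : ℝ) (N : ℕ) : ℝ :=
  if h : 1 < N then chainCov ω₂ γ N 1 0 (Sum.inl ⟨0, by omega⟩) (Sum.inr ⟨1, h⟩) else 0

/-- The position–momentum block of the Gibbs covariance vanishes. [folklore] -/
theorem gibbsCov_inl_inr (ω₂ : ℝ) {N : ℕ} (i j : Fin N) :
    gibbsCov ω₂ N (Sum.inl i) (Sum.inr j) = 0 := by
  simp [gibbsCov]

/-- **Mean bond current = `c_N (T_L - T_R)`.** For all bath temperatures the stationary
covariance `⟨q_i p_{i+1}⟩` of every bond equals `fluxCoeff ω₂ γ N · (T_L - T_R)`: it is linear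
in `(T_L, T_R)`, the same for all bonds, and vanishes at equal temperatures (Gibbs state).
[Bonetto–Lebowitz–Rey-Bellet 2000, §6.2 ("non-vanishing covariances between position and
momentum variables proportional to `δT`")] [cite: BonettoLebowitzReyBellet2000, §6.2] -/
theorem chainCov_bond_eq_fluxCoeff (hω : 0 < ω₂) (hγ : 0 < γ) {N : ℕ} (T_L T_R : ℝ) (n : ℕ)
    (hn : n + 1 < N) :
    chainCov ω₂ γ N T_L T_R (Sum.inl ⟨n, by omega⟩) (Sum.inr ⟨n + 1, hn⟩) =
      fluxCoeff ω₂ γ N * (T_L - T_R) := by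
  have hN : 1 < N := by omega
  rw [chainCov_bond_eq hω hγ T_L T_R n hn, fluxCoeff, dif_pos hN, chainCov_eq_add hω hγ N T_L T_R,
    Matrix.add_apply, Matrix.smul_apply, Matrix.smul_apply, smul_eq_mul, smul_eq_mul]
  have hsum := congrFun (congrFun (chainCov_one_zero_add hω hγ N) (Sum.inl ⟨0, by omega⟩))
    (Sum.inr ⟨1, hN⟩)
  rw [Matrix.add_apply, gibbsCov_inl_inr] at hsum
  have : chainCov ω₂ γ N 0 1 (Sum.inl ⟨0, by omega⟩) (Sum.inr ⟨1, hN⟩) =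
      -chainCov ω₂ γ N 1 0 (Sum.inl ⟨0, by omega⟩) (Sum.inr ⟨1, hN⟩) := by linarith
  rw [this]
  ring

end Currents

end Literature.MathematicalPhysics.KineticTheory.HeatConduction
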